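import Literature.MathematicalPhysics.QuantumFieldTheory.Balaban1983to89.B6Prop22DerivMultiLevelTorus
import Literature.MathematicalPhysics.QuantumFieldTheory.Balaban1983to89.B6Prop22HolderMultiLevelBoxRateUnif

/-!
# `Balaban1983to89.B6Prop22HolderMultiLevelTorus` — [B6] PROPOSITION 2.2, FOURTH ENTRY OF (2.67) (`‖ζ∇^η_xG′λ‖_α`), FOR
# THE GENUINE `k`-LEVEL OPERATOR `G′ = Δ′_a^{−1}` ON THE TORUS `T_η` (print's carrier, `Ω₁ = T_η`):
# `|x′−x|_T^{−α}|((∇^η_μG′λ)(x′) − (∇^η_μG′λ)(x))| ≤ O(1)(L^jη)^{1−α}e^{−½δ₀d_T(y,y′)}|λ|`, `x, x′ ∈ B^j(y)`, with the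
# PERIODIC differences — by the printed route (2.64)–(2.66) applied to the fixed point `∇G′ = ∇G′₀ + (∇G′)R` differenced
# over pairs and lifted to `pairs ⊕ sites`, every cube term read in its translation chart (file T9 of the torus
# carrier; no existing module is touched; no fact is minted)

FRAMING (verbatim cell line):
statement-level skeleton of published theorems with citation tags; proofs where landed; nothing here is a claim about the Yang–Mills mass gap

Source under audit (cell pub-balaban / lit-balaban): T. Bałaban, *Propagators and renormalization transformations for
lattice gauge theories. II*, Commun. Math. Phys. **96** (1984) 223–250 [`Balaban1984PropagatorsII`, "B6"], p. 234
[PDF 12] (2.64)–(2.67), Proposition 2.2; p. 224 [PDF 2] (2.1)–(2.4) («we admit the case when some domains Ω_j are equal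
to T_η»); [3] = T. Bałaban, *Regularity and decay of lattice Green's functions*, Commun. Math. Phys. **89** (1983)
571–597 [`Balaban1983RegularityDecay`], Theorem (1.9) p. 573 (held text `paper:balaban1984-cmp96-propagators-rt-ii`,
p0002/p0012).  Unit `lit-balaban-p21` (Phase-2 proof seat p21 gen 15), HOME `run/shared/lean/pub/lit-balaban/`, B6 fold
owner r03, referee ref-4.  Box siblings (consumed BY NAME, untouched): `B6Prop22HolderMultiLevelBox` (file 11: the lifts
`liftL`/`liftR`, the chain on `pairs ⊕ sites`), `B6HolderTermMultiLevelBox` (file 10: the per-term pair bound `aX_dd_le`,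
stated for EVERY family of domains on the fundamental box — hence for every chart).

## WHAT IS PRINTED (p. 234, verbatim up to notation)

«… The similar inequalities hold for a derivative of G′λ and for a Hölder norm of a derivative, but with (L^jη)²
replaced by L^jη and (L^jη)^{1−α} correspondingly. … **Proposition 2.2.** If we have (2.1), (2.2) and M is sufficiently
large, then the operator G′ = Δ′_a^{−1} (a = 1) satisfies the inequalities |(G′λ)(x)|, |(∇^η_xG′λ)(x)|, |(G′∇^{η*}λ)(x)|,
‖ζ∇^η_xG′λ‖_α, ‖ζG′∇^{η*}λ‖_α, |(Δ^ηG′λ)(x)| ≤ O(1)[(L^jη)², L^jη, L^jη, (L^jη)^{1−α}(‖ζ‖_α + |ζ|),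
(L^jη)^{1−α}(‖ζ‖_α + |ζ|), 1]·e^{−½δ₀d(y,y′)}|λ|, x ∈ B^j(y) or supp ζ ⊂ B^j(y), y ∈ Λ_j, supp λ ⊂ B^{j′}(y′),
y′ ∈ Λ_{j′}. (2.67)»; p. 224: «Ω₁ ⊃ Ω₂ ⊃ … ⊃ Ω_k, Ω_j ⊂ T_η, j = 1, 2, …, k» (2.1) and «we admit the case when some
domains Ω_j are equal to T_η».

## WHAT THIS FILE CERTIFIES (kernel-checked; setting of files T1–T6)

* §1 **CHART COHERENCE OVER A PAIR**: torus translations by multiples of the block size move the sites of one block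
  RIGIDLY (`tshift_val_sub_of_blk`, `σc_symm_sub_of_blkOf`: `σ⁻¹x′ − σ⁻¹x = x′ − x` for `x, x′` of one block of `𝔅`);
  the torus sup-distance of two sites of one block is their lattice distance (`torusSupNorm_sub_of_blkOf`); the DEPTH of
  the central cube of a chart (`margin_of_uX_ne_zero`: `h_□(z) ≠ 0 ⇒ N_j ≤ z_μ < N₀,μ − N_j`), whence (with the two-level
  window of the box lineage) the four points `σ⁻¹x, σ⁻¹x + e_μ, σ⁻¹x′, σ⁻¹x′ + e_μ` of a pair meeting a cube term all lie
  in the chart box (`add_unit_mem_of_uX_ne_zero`) and the term is keyed AT `x` (`mem_keySet_of_uX_pair`, `M_h ≥ 3`);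
* §2 the same-block pairs of the torus (`HPairT`: `x ≠ x′`, one block of `𝔅`; the periodic shifts need no membership
  proviso), the Hölder-weighted mixed PERIODIC difference `(Dd_T f)(x,x′) = |x′−x|_T^{−α}((f(x′+e_μ) − f(x′)) − (f(x+e_μ)
  − f(x)))`, the functional `T(M) = Dd_T ∘ M` and **THE LIFTED FIXED POINT** `liftL T(G′) = liftL T(G′₀) + liftL T(G′)·
  liftR R` from `G′ = G′₀ + G′R` on the torus ((2.38)/(2.50), file T2's `eq238_multiLevelTorus`);
* §3 **THE PAIR-ROW BOUND OF `T(G′₀)` ON THE TORUS** `holderZeroT_rowBound`: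
  `|T(G′₀)λ(x,x′)| ≤ A·(L^{j})^{1−α}·e^{−δ₅d_T(y,y′)/(d+1)}|λ|` — every transported term `σ(h_□G′(□)v_□)σ⁻¹` is the box
  lineage's term of the central cube of its chart evaluated over the RIGIDLY translated pair (§1), bounded by file 10's
  `aX_dd_le` applied to the chart family `Dc`, the support distance read from `d_{chart} ≥ d_T`; at most `3·2^{d+1}` terms;
* §4 **PROPOSITION 2.2, FOURTH ENTRY, FOR THE GENUINE `k`-LEVEL OPERATOR ON THE TORUS**, with ONE rate `δ₀` and ONE
  threshold for all `α` (`…_unif`, from the box lineage's `α`-uniform per-term rate `aX_dd_le_unif`) and the per-`α`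
  forms as corollaries: `hasMajorant_holder_multiLevelTorus`
  (the lift of `T(G′)` has the majorant `C·(L^{j})^{1−α}·e^{−½δ₀d_T(y,y′)}` on `𝔅`: the majorants of `R` ((2.64) on
  `T_η`, file T4) and of `T(G′₀)` (§3), Lemma 2.1 on the torus (file T3), the chain on `pairs ⊕ sites`) and the printed
  form `prop22_fourth_multiLevelTorus`: for `0 ≤ α < 1` there are `δ₀, C, M₀ > 0`, `N₀ ≥ 1` (functions of `d`, `ℓ`, `α`,
  the windows — NOT of the torus) such that for every `k`, `M_h ≥ 3` with `L·M_h ≥ M₀`, `R ≥ 2L` with `RM ≥ N₀ + 1`, torus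
  size `P` (`P_μ ≥ 4`), nested family `D` of domains of the torus, weights in the windows with `a_{i+1} = aNext ℓ a_i c_i`,
  axis `μ`, `λ` supported in `B^{j′}(y′)` and all `x ≠ x′` of one block `B^j(y)`:
  `|x′−x|_T^{−α}·|((G′λ)(x′+e_μ) − (G′λ)(x′)) − ((G′λ)(x+e_μ) − (G′λ)(x))| ≤ C·(L^{j})^{1−α}·e^{−½δ₀d_T(y,y′)}·sup|λ|`.

## HONEST SCOPE

As files T1–T6 and the box files 10–11: levels `1 … k`, `Ω₁ = T_η` (no level `0`/`a₀ = +∞`), `m² = 0`, `P_μ ≥ 4`,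
asymmetric partition, `M_h ≥ 3`, `R ≥ 2L`, Neumann two-level cube inverses; lattice units (`G′` here is `η^{−2}G′` of
print and the differences are `η∇^η`, whence `(L^{j})^{1−α}` for «(L^jη)^{1−α}»); the Hölder quotient of `∇^η_μG′λ` is
taken over the pairs of ONE block `B^j(y)` (print: «supp ζ ⊂ B^j(y)») with the torus sup-distance (= the lattice distance
on a block), the cut-off `ζ` and the factor `(‖ζ‖_α + |ζ|)` being dispensed with as in [3] (1.9); `0 ≤ α < 1` with rate
and constants depending on `α`; the (2.61)-constant is the `L`-dependent one of `B6Ineq261LevelGap`; constants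
existential.  The fifth entry `‖ζG′∇^{η*}λ‖_α` on the torus is NOT treated here.  Nothing is inferred from the
manuscript: every step is kernel-checked.
-/

namespace Literature.MathematicalPhysics.QuantumFieldTheory.Balaban1983to89.B6Prop22HolderMultiLevelTorus

open Finset Matrix
open Literature.MathematicalPhysics.QuantumFieldTheory.Balaban1983to89.B4ContourShift (supNorm supNorm_nonneg
  abs_le_supNorm)
open Literature.MathematicalPhysics.QuantumFieldTheory.Balaban1983to89.B4Reflection242 (boxDom mem_boxDom blk nbrs
  mem_nbrs)
open Literature.MathematicalPhysics.QuantumFieldTheory.Balaban1983to89.B4TorusKernel.MultiPeriod (torusSupNorm circAbs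
  torusSupNorm_of_centred torusSupNorm_nonneg)
open Literature.MathematicalPhysics.QuantumFieldTheory.Balaban1983to89.B6Ineq243TwoLevelBox
open Literature.MathematicalPhysics.QuantumFieldTheory.Balaban1983to89.B6Partition236TwoLevelBox
open Literature.MathematicalPhysics.QuantumFieldTheory.Balaban1983to89.B6Eq238TwoLevelBox
open Literature.MathematicalPhysics.QuantumFieldTheory.Balaban1983to89.B6Ineq249TwoLevelBox (near card_near_le
  mem_near_of_abs_lt)
open Literature.MathematicalPhysics.QuantumFieldTheory.Balaban1983to89.B6MultiLevelBoxOperator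
open Literature.MathematicalPhysics.QuantumFieldTheory.Balaban1983to89.B6Eq238MultiLevelBox
open Literature.MathematicalPhysics.QuantumFieldTheory.Balaban1983to89.B6Ineq249MultiLevelBox
open Literature.MathematicalPhysics.QuantumFieldTheory.Balaban1983to89.B6Geom246MultiLevelBox
open Literature.MathematicalPhysics.QuantumFieldTheory.Balaban1983to89.B6Prop22MultiLevelBox
open Literature.MathematicalPhysics.QuantumFieldTheory.Balaban1983to89.B6RandomWalk (HasMajorant BlockSupp
  hasMajorant_mono)
open Literature.MathematicalPhysics.QuantumFieldTheory.Balaban1983to89.B6Ineq261LevelGap (K261 K261_nonneg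
  theta_lt_one_of_log)
open Literature.MathematicalPhysics.QuantumFieldTheory.Balaban1983to89.B6Prop23Chain (majorant_of_fixedPoint_266W)
open Literature.MathematicalPhysics.QuantumFieldTheory.Balaban1983to89.B6Prop22HolderMultiLevelBoxRateUnif (aX_dd_le_unif)
open Literature.MathematicalPhysics.QuantumFieldTheory.Balaban1983to89.B6Prop22HolderMultiLevelBox (liftL liftR
  liftL_apply_inl liftL_mul_liftR liftL_add hasMajorant_liftR hasMajorant_liftL rowBound_of_hasMajorant_liftL)
open Literature.MathematicalPhysics.QuantumFieldTheory.Balaban1983to89.B6MultiLevelTorusOperator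
open Literature.MathematicalPhysics.QuantumFieldTheory.Balaban1983to89.B6Eq238MultiLevelTorus
open Literature.MathematicalPhysics.QuantumFieldTheory.Balaban1983to89.B6Geom246MultiLevelTorus
open Literature.MathematicalPhysics.QuantumFieldTheory.Balaban1983to89.B6Prop22MultiLevelTorus
open Literature.MathematicalPhysics.QuantumFieldTheory.Balaban1983to89.B6Prop22DerivMultiLevelTorus (σc_symm_tshift
  not_interior_tshift_of_not_mem uX_central_eq_zero mem_keySet_of_uX_ne_zero_nbr)

noncomputable section

variable {d : ℕ}

/-! ## §0 Tools -/

section Tools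

/-- a sum over a finite type whose non-zero terms are indexed injectively into a finset `T` and are bounded by
`B ≥ 0` is at most `|T|·B`. [folklore] -/
private theorem sum_le_card_mul {ι σ : Type*} [Fintype ι] [DecidableEq σ] (f : ι → ℝ) (key : ι → σ)
    (hkey : Function.Injective key) (T : Finset σ) (hT : ∀ i, f i ≠ 0 → key i ∈ T) {B : ℝ} (hB : 0 ≤ B)
    (hf : ∀ i, f i ≤ B) : ∑ i, f i ≤ T.card * B := by
  classical
  rw [← Finset.sum_filter_ne_zero]
  have hcard : (Finset.univ.filter fun i => f i ≠ 0).card ≤ T.card :=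
    Finset.card_le_card_of_injOn key (fun i hi => by
      rw [Finset.coe_filter] at hi; exact hT i hi.2) (fun i _ j _ h => hkey h)
  calc ∑ i ∈ Finset.univ.filter (fun i => f i ≠ 0), f i
      ≤ (Finset.univ.filter fun i => f i ≠ 0).card • B := Finset.sum_le_card_nsmul _ _ _ fun i _ => hf i
    _ = ((Finset.univ.filter fun i => f i ≠ 0).card : ℝ) * B := by rw [nsmul_eq_mul]
    _ ≤ T.card * B := mul_le_mul_of_nonneg_right (by exact_mod_cast hcard) hB

/-- `(reindex e e A)·v` at `z` is `A·(v ∘ e)` at `e⁻¹z`. [folklore] -/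
private theorem reindex_mulVec_apply {X Y : Type*} [Fintype X] [Fintype Y] (e : X ≃ Y) (A : Matrix X X ℝ) (v : Y → ℝ)
    (z : Y) : (Matrix.reindex e e A *ᵥ v) z = (A *ᵥ (v ∘ e)) (e.symm z) := by
  rw [Matrix.reindex_apply, Matrix.submatrix_mulVec_equiv, Equiv.symm_symm, Function.comp_apply]

/-- two integers with the same quotient by `b ≥ 1` differ by less than `b`. [folklore] -/
private theorem abs_sub_lt_of_ediv_eq {b : ℕ} (hb : 1 ≤ b) {u v : ℤ} (h : u / (b : ℤ) = v / (b : ℤ)) :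
    |u - v| < (b : ℤ) := by
  have hb0 : (0 : ℤ) < b := by exact_mod_cast hb
  have hu := Int.emod_add_mul_ediv u b
  have hv := Int.emod_add_mul_ediv v b
  have h1 := Int.emod_nonneg u hb0.ne'
  have h2 := Int.emod_lt_of_pos u hb0
  have h3 := Int.emod_nonneg v hb0.ne'
  have h4 := Int.emod_lt_of_pos v hb0
  rw [abs_lt]
  rw [h] at hu
  constructor <;> linarith

/-- the level window encoded by a key set. [cite: Balaban1984PropagatorsII, p.229 (cover of finite overlap), dictionary] -/
private theorem level_window_of_mem_keySet {ℓ Mh l : ℕ} {z : Fin (d + 1) → ℤ} {cq : ℕ × (Fin (d + 1) → ℤ)}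
    (h : cq ∈ keySet ℓ Mh l z) : l ≤ cq.1 + 1 ∧ cq.1 ≤ l + 1 := by
  unfold keySet at h
  rw [Finset.mem_biUnion] at h
  obtain ⟨j, hj, hmem⟩ := h
  rw [Finset.mem_image] at hmem
  obtain ⟨q, -, he⟩ := hmem
  rw [Finset.mem_Icc] at hj
  have : cq.1 = j := by rw [← he]
  omega

end Tools

/-! ## §1 Chart coherence over a pair: rigid translation of a block, torus distance on a block, depth of the central cube -/

section Coherence

/-- **A TORUS TRANSLATION BY A MULTIPLE OF THE BLOCK SIZE MOVES THE SITES OF ONE BLOCK RIGIDLY**: for `b ∣ t_i`,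
`N_i = bν_i` and `x, x′` of one `b`-block, `σ_t x′ − σ_t x = x′ − x` (the block does not straddle the seam).
[cite: Balaban1983RegularityDecay, p.572 («a torus T_η … with periodic conditions»), dictionary] -/
theorem tshift_val_sub_of_blk {b : ℕ} (hb : 1 ≤ b) {N : Fin (d + 1) → ℕ} {ν : Fin (d + 1) → ℕ} (hN : ∀ i, N i = b * ν i)
    (hν : ∀ i, 1 ≤ ν i) {t τ : Fin (d + 1) → ℤ} (ht : ∀ i, t i = b * τ i) {x x' : ↥(boxDom N)}
    (h : blk b x'.1 = blk b x.1) : (tshift N t x').1 - (tshift N t x).1 = x'.1 - x.1 := by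
  have hbi : ∀ i, (b : ℤ) ∣ (N i : ℤ) := fun i => ⟨ν i, by rw [hN i]; push_cast; ring⟩
  funext i
  have hq : x'.1 i / (b : ℤ) = x.1 i / (b : ℤ) := by
    have := congrFun h i; simpa only [blk] using this
  have e : ∀ y : ↥(boxDom N), (tshift N t y).1 i = (b : ℤ) * ((blk b y.1 i + τ i) % (ν i : ℤ)) + y.1 i % (b : ℤ) := by
    intro y
    have h1 := blk_twrap_add hb hN hν ht y.1 i
    have h2 : twrap N (y.1 + t) i % (b : ℤ) = y.1 i % (b : ℤ) := by
      simp only [twrap, Pi.add_apply]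
      rw [Int.emod_emod_of_dvd _ (hbi i), ht i, Int.add_mul_emod_self_left]
    have h3 := Int.emod_add_mul_ediv (twrap N (y.1 + t) i) (b : ℤ)
    simp only [blk] at h1
    rw [tshift_val, ← h3, h1, h2]
    simp only [blk]
    ring
  rw [Pi.sub_apply, Pi.sub_apply, e x', e x, show blk b x'.1 i = blk b x.1 i from congrFun h i]
  have h4 := Int.emod_add_mul_ediv (x'.1 i) (b : ℤ)
  have h5 := Int.emod_add_mul_ediv (x.1 i) (b : ℤ)
  rw [hq] at h4
  linarith

variable {ℓ Mh k R : ℕ} {P : Fin (d + 1) → ℕ} {D : TDomains d ℓ Mh k P R}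

/-- two sites of one block of `𝔅` have the same level and coordinates differing by less than the block side `L^j`.
[cite: Balaban1984PropagatorsII, (2.45) p.231 («B^j(y)»), dictionary] -/
theorem abs_sub_lt_of_blkOf_eq {D' : Domains d ℓ Mh k P R} {x x' : ↥(boxDom (N0 ℓ Mh k P))}
    (h : blkOf D' x' = blkOf D' x) (ν : Fin (d + 1)) :
    |x'.1 ν - x.1 ν| < (((ℓ + 1) ^ D'.lev x.1 : ℕ) : ℤ) := by
  have hval := congrArg Subtype.val h
  simp only [blkOf_val, Prod.mk.injEq] at hval
  obtain ⟨hlev, hblk⟩ := hval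
  rw [hlev] at hblk
  have hq : x'.1 ν / ((((ℓ + 1) ^ D'.lev x.1 : ℕ) : ℤ)) = x.1 ν / ((((ℓ + 1) ^ D'.lev x.1 : ℕ) : ℤ)) := by
    have := congrFun hblk ν; simpa only [blk] using this
  exact abs_sub_lt_of_ediv_eq (Nat.one_le_pow _ _ (by omega)) hq

/-- **THE CHART MOVES A PAIR OF ONE BLOCK RIGIDLY**: `σ⁻¹x′ − σ⁻¹x = x′ − x` for `x, x′` of one block of `𝔅` (the chart
translation is a multiple of `M·L^k`, hence of every block side). [cite: Balaban1984PropagatorsII, (2.45) p.231, p.229, dictionary] -/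
theorem σc_symm_sub_of_blkOf (hMh : 1 ≤ Mh) (hP : ∀ μ, 1 ≤ P μ) (j : ℕ) (q : Fin (d + 1) → ℤ)
    {x x' : ↥(boxDom (N0 ℓ Mh k P))} (h : blkOf D.toDomains x' = blkOf D.toDomains x) :
    ((σc ℓ Mh k P j q).symm x').1 - ((σc ℓ Mh k P j q).symm x).1 = x'.1 - x.1 := by
  have hval := congrArg Subtype.val h
  simp only [blkOf_val, Prod.mk.injEq, TDomains.toDomains_lev] at hval
  obtain ⟨hlev, hblk⟩ := hval
  rw [hlev] at hblk
  have hi : D.lev x.1 ≤ k + 1 := le_trans (D.lev_le x.1) (Nat.le_succ k)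
  obtain ⟨c, hc⟩ := TDomains.pow_dvd_bigSide (ℓ := ℓ) (Mh := Mh) (k := k) hi
  have hb : 1 ≤ (ℓ + 1) ^ D.lev x.1 := Nat.one_le_pow _ _ (by omega)
  have hc1 : 1 ≤ c := Nat.one_le_iff_ne_zero.2 fun h0 => by
    have := one_le_bigSide (ℓ := ℓ) hMh k; rw [hc, h0, mul_zero] at this; exact absurd this (by norm_num)
  unfold σc
  rw [tshift_symm_apply, tshift_symm_apply]
  exact tshift_val_sub_of_blk hb (N := N0 ℓ Mh k P) (ν := fun i => c * P i)
    (fun i => by rw [N0_eq_bigSide_mul, hc, mul_assoc]) (fun i => Nat.mul_le_mul hc1 (hP i))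
    (t := -TDomains.tvec ℓ Mh k (svec ℓ k j q)) (τ := fun i => -((c : ℤ) * svec ℓ k j q i))
    (fun i => by simp only [Pi.neg_apply, TDomains.tvec, hc]; push_cast; ring) hblk

/-- **THE TORUS DISTANCE OF TWO SITES OF ONE BLOCK IS THEIR LATTICE DISTANCE** (a block of side `L^j ≤ M·L^k ≤ N₀/4` is
centred). [cite: Balaban1984PropagatorsII, (2.45) p.231; Balaban1983RegularityDecay, p.572, dictionary] -/
theorem torusSupNorm_sub_of_blkOf (hMh : 1 ≤ Mh) (hP4 : ∀ μ, 4 ≤ P μ) {x x' : ↥(boxDom (N0 ℓ Mh k P))}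
    (h : blkOf D.toDomains x' = blkOf D.toDomains x) :
    torusSupNorm (N0 ℓ Mh k P) (x'.1 - x.1) = supNorm (x'.1 - x.1) := by
  have hP : ∀ μ, 1 ≤ P μ := fun μ => le_trans (by norm_num) (hP4 μ)
  refine torusSupNorm_of_centred (one_le_N0 hMh hP) fun i => ?_
  have h1 := abs_sub_lt_of_blkOf_eq (D' := D.toDomains) h i
  rw [Pi.sub_apply]
  have hle : (ℓ + 1) ^ D.toDomains.lev x.1 ≤ bigSide ℓ Mh k := by
    rw [TDomains.toDomains_lev]
    obtain ⟨c, hc⟩ := TDomains.pow_dvd_bigSide (ℓ := ℓ) (Mh := Mh) (k := k)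
      (le_trans (D.lev_le x.1) (Nat.le_succ k))
    have hc1 : 1 ≤ c := Nat.one_le_iff_ne_zero.2 fun h0 => by
      have := one_le_bigSide (ℓ := ℓ) hMh k; rw [hc, h0, mul_zero] at this; exact absurd this (by norm_num)
    calc (ℓ + 1) ^ D.lev x.1 = (ℓ + 1) ^ D.lev x.1 * 1 := (mul_one _).symm
      _ ≤ (ℓ + 1) ^ D.lev x.1 * c := Nat.mul_le_mul_left _ hc1
      _ = bigSide ℓ Mh k := hc.symm
  have hN : bigSide ℓ Mh k * 4 ≤ N0 ℓ Mh k P i := by rw [N0_eq_bigSide_mul]; exact Nat.mul_le_mul_left _ (hP4 i)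
  have h2 : (((ℓ + 1) ^ D.toDomains.lev x.1 : ℕ) : ℤ) * 4 ≤ (N0 ℓ Mh k P i : ℤ) := by
    have : (ℓ + 1) ^ D.toDomains.lev x.1 * 4 ≤ N0 ℓ Mh k P i := le_trans (Nat.mul_le_mul_right _ hle) hN
    exact_mod_cast this
  linarith [abs_nonneg (x'.1 i - x.1 i)]

/-- **THE DEPTH OF THE CENTRAL CUBE OF A CHART**: where the profile `h_□` of the central cube `(j, qc)` does not vanish,
every coordinate is at least `N_j = M·L^j` away from both walls of the fundamental box (`N₀ = N_j·P_j`, the label window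
`2 ≤ qc ≤ P_j − 2`, the ⅝-support of (1.118)). [cite: Balaban1984PropagatorsII, (2.36) p.229; Balaban1984PropagatorsI, (1.118) p.36] -/
theorem margin_of_uX_ne_zero (hℓ : 1 ≤ ℓ) (hMh : 1 ≤ Mh) (hP4 : ∀ μ, 4 ≤ P μ) {j : ℕ} (hjk : j ≤ k)
    (q : Fin (d + 1) → ℤ) {z : ↥(boxDom (N0 ℓ Mh k P))}
    (hz : uX (ℓ := ℓ) (Mh := Mh) (k := k) (P := P) (j, qc ℓ k j q) z ≠ 0) (μ : Fin (d + 1)) :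
    ((bigSide ℓ Mh j : ℕ) : ℤ) ≤ z.1 μ ∧ z.1 μ + bigSide ℓ Mh j < (N0 ℓ Mh k P μ : ℤ) := by
  have hN1 : 1 ≤ (ℓ + 1) ^ j * ((ℓ + 1) * Mh) := Nat.one_le_iff_ne_zero.2 (by positivity)
  have hNM : (ℓ + 1) ^ j * ((ℓ + 1) * Mh) = bigSide ℓ Mh j := by rw [bigSide_eq]; ring
  have hz' : hq ((ℓ + 1) ^ j) ((ℓ + 1) * Mh) (qc ℓ k j q) z.1 ≠ 0 := hz
  have h := abs_lt_of_hq_ne_zero hN1 hz' μ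
  obtain ⟨hq2, hqP⟩ := qc_bounds (ℓ := ℓ) (k := k) hP4 j q μ
  set Nj : ℝ := (((ℓ + 1) ^ j * ((ℓ + 1) * Mh) : ℕ) : ℝ) with hNj
  have hNjb : Nj = ((bigSide ℓ Mh j : ℕ) : ℝ) := by rw [hNj, hNM]
  have h2nat : 2 ≤ bigSide ℓ Mh j := by
    have h2 : 2 ≤ (ℓ + 1) ^ (j + 1) := le_trans (show 2 ≤ ℓ + 1 by omega) (Nat.le_self_pow (by omega) _)
    unfold bigSide
    calc 2 = 1 * 2 := by ring
      _ ≤ Mh * (ℓ + 1) ^ (j + 1) := Nat.mul_le_mul hMh h2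
  have hNj2 : (2 : ℝ) ≤ Nj := by rw [hNjb]; exact_mod_cast h2nat
  have hq2r : (2 : ℝ) ≤ (qc ℓ k j q μ : ℝ) := by exact_mod_cast hq2
  have hqPr : (qc ℓ k j q μ : ℝ) + 2 ≤ (Pj ℓ k P j μ : ℝ) := by exact_mod_cast hqP
  have hN0 : (N0 ℓ Mh k P μ : ℝ) = Nj * (Pj ℓ k P j μ : ℝ) := by
    rw [N0_eq_mul_Pj hjk μ]; push_cast; rw [hNj]; push_cast; ring
  rw [abs_lt] at h
  simp only [pos] at h
  obtain ⟨h1, h2⟩ := h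
  have hlo : Nj * 2 ≤ Nj * (qc ℓ k j q μ : ℝ) := mul_le_mul_of_nonneg_left hq2r (by linarith)
  have hhi : Nj * ((qc ℓ k j q μ : ℝ) + 2) ≤ Nj * (Pj ℓ k P j μ : ℝ) := mul_le_mul_of_nonneg_left hqPr (by linarith)
  constructor
  · have hr : ((bigSide ℓ Mh j : ℕ) : ℝ) - 1 < ((z.1 μ : ℤ) : ℝ) := by rw [← hNjb]; linarith
    have hi : ((bigSide ℓ Mh j : ℕ) : ℤ) - 1 < z.1 μ := by exact_mod_cast hr
    omega
  · have hr : ((z.1 μ : ℤ) : ℝ) + ((bigSide ℓ Mh j : ℕ) : ℝ) < (N0 ℓ Mh k P μ : ℝ) := by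
      rw [← hNjb, hN0]; linarith
    exact_mod_cast hr

/-- **THE FOUR POINTS OF A PAIR MEETING A CUBE TERM LIE IN THE CHART BOX**: if the central profile of the chart of a
torus cube does not vanish at `z ∈ {v, v + e_μ}` for a site `v` of the block of `w` (in the chart), then `w + e_μ` is a
site of the chart box (the depth `N_j` of the cube exceeds the block side `L^i ≤ L^{j+1}` by the two-level window).
[cite: Balaban1984PropagatorsII, p.229 (cover of finite overlap), (2.36) p.229, (2.2) p.224] -/
theorem add_unit_mem_of_uX_ne_zero (hℓ : 1 ≤ ℓ) (hR : 2 * (ℓ + 1) ≤ R) (hP : ∀ μ, 1 ≤ P μ) (hP4 : ∀ μ, 4 ≤ P μ)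
    (hMh : 1 ≤ Mh) {cq : ℕ × (Fin (d + 1) → ℤ)} (hc : CubeDataT D cq) (μ : Fin (d + 1))
    {w v z : ↥(boxDom (N0 ℓ Mh k P))} (hvw : blkOf (Dc D cq.1 cq.2) v = blkOf (Dc D cq.1 cq.2) w)
    (hz : z = v ∨ z = tshift (N0 ℓ Mh k P) (unitVec μ) v)
    (hu : uX (ℓ := ℓ) (Mh := Mh) (k := k) (P := P) (cq.1, qc ℓ k cq.1 cq.2) z ≠ 0) :
    w.1 + Pi.single μ 1 ∈ boxDom (N0 ℓ Mh k P) := by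
  -- `z` is `v` or its lattice neighbour `v + e_μ` (a wrapped neighbour would lie on the wall, where `h_□ = 0`)
  have hzval : z.1 = v.1 ∨ z.1 = v.1 + Pi.single μ 1 := by
    rcases hz with hz | hz
    · exact Or.inl (by rw [hz])
    · right
      by_cases hmem : v.1 + Pi.single μ 1 ∈ boxDom (N0 ℓ Mh k P)
      · rw [hz]; exact tshift_val_of_mem hmem
      · exfalso
        exact hu (by rw [hz]; exact uX_central_eq_zero hMh hP4 hc (not_interior_tshift_of_not_mem hmem))
  have hvz : v.1 ∈ nbrs z.1 ∨ v = z := by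
    rcases hzval with h | h
    · exact Or.inr (Subtype.ext h.symm)
    · exact Or.inl (mem_nbrs.2 ⟨μ, Or.inr (by rw [h, add_sub_cancel_right])⟩)
  -- the two-level window at `v`: `lev v ≤ j + 1`
  have hkey := mem_keySet_of_uX_ne_zero_nbr hℓ hR hP hMh _ (cubeData_chart hP4 hc) hu hvz
  obtain ⟨hwin, -⟩ := level_window_of_mem_keySet hkey
  -- the depth of the cube at `z` and the spread of the block
  have hmar := margin_of_uX_ne_zero hℓ hMh hP4 hc.hj.2 cq.2 hu
  have hlevw : (Dc D cq.1 cq.2).lev w.1 = (Dc D cq.1 cq.2).lev v.1 := by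
    have hval := congrArg Subtype.val hvw
    simp only [blkOf_val, Prod.mk.injEq] at hval
    exact hval.1.symm
  have hspread := abs_sub_lt_of_blkOf_eq hvw
  have hpow : (ℓ + 1) ^ (Dc D cq.1 cq.2).lev w.1 ≤ bigSide ℓ Mh cq.1 := by
    unfold bigSide
    calc (ℓ + 1) ^ (Dc D cq.1 cq.2).lev w.1 ≤ (ℓ + 1) ^ (cq.1 + 1) :=
          Nat.pow_le_pow_right (by omega) (by rw [hlevw]; simpa using hwin)
      _ = 1 * (ℓ + 1) ^ (cq.1 + 1) := (one_mul _).symm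
      _ ≤ Mh * (ℓ + 1) ^ (cq.1 + 1) := Nat.mul_le_mul_right _ hMh
  have hpow' : (((ℓ + 1) ^ (Dc D cq.1 cq.2).lev w.1 : ℕ) : ℤ) ≤ ((bigSide ℓ Mh cq.1 : ℕ) : ℤ) := by exact_mod_cast hpow
  rw [mem_boxDom]
  intro ν
  have hwν := (mem_boxDom.1 w.2) ν
  by_cases hν : ν = μ
  · subst hν
    rw [Pi.add_apply, Pi.single_eq_same]
    refine ⟨by omega, ?_⟩
    have hs := hspread ν
    rw [abs_lt] at hs
    have hzv : v.1 ν ≤ z.1 ν := by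
      rcases hzval with h | h
      · rw [h]
      · rw [h, Pi.add_apply, Pi.single_eq_same]; omega
    have := (hmar ν).2
    omega
  · rw [Pi.add_apply, Pi.single_eq_of_ne hν, add_zero]
    exact hwν

/-- **A CUBE TERM MEETING A PAIR IS KEYED AT THE FIRST POINT** (`M_h ≥ 3`): if the central profile of the chart of the
torus cube `(j, q)` does not vanish at `z ∈ {v, v + e_μ}` for a site `v` of the block of `w` (in the chart), then
`(j, qc)` is one of the `≤ 3·2^{d+1}` keys at `w` (the ⅝-support plus the block side `L^i ≤ L^{j+1} ≤ ⅜N_j`).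
[cite: Balaban1984PropagatorsII, p.229 (cover of finite overlap); Balaban1984PropagatorsI, (1.118) p.36] -/
theorem mem_keySet_of_uX_pair (hℓ : 1 ≤ ℓ) (hR : 2 * (ℓ + 1) ≤ R) (hP : ∀ μ, 1 ≤ P μ) (hP4 : ∀ μ, 4 ≤ P μ)
    (hMh : 3 ≤ Mh) {cq : ℕ × (Fin (d + 1) → ℤ)} (hc : CubeDataT D cq) (μ : Fin (d + 1))
    {w v z : ↥(boxDom (N0 ℓ Mh k P))} (hvw : blkOf (Dc D cq.1 cq.2) v = blkOf (Dc D cq.1 cq.2) w)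
    (hz : z = v ∨ z = tshift (N0 ℓ Mh k P) (unitVec μ) v)
    (hu : uX (ℓ := ℓ) (Mh := Mh) (k := k) (P := P) (cq.1, qc ℓ k cq.1 cq.2) z ≠ 0) :
    (cq.1, qc ℓ k cq.1 cq.2) ∈ keySet ℓ Mh ((Dc D cq.1 cq.2).lev w.1) w.1 := by
  have hMh1 : 1 ≤ Mh := le_trans (by norm_num) hMh
  have hzval : z.1 = v.1 ∨ z.1 = v.1 + Pi.single μ 1 := by
    rcases hz with hz | hz
    · exact Or.inl (by rw [hz])
    · right
      by_cases hmem : v.1 + Pi.single μ 1 ∈ boxDom (N0 ℓ Mh k P)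
      · rw [hz]; exact tshift_val_of_mem hmem
      · exfalso
        exact hu (by rw [hz]; exact uX_central_eq_zero hMh1 hP4 hc (not_interior_tshift_of_not_mem hmem))
  have hvz : v.1 ∈ nbrs z.1 ∨ v = z := by
    rcases hzval with h | h
    · exact Or.inr (Subtype.ext h.symm)
    · exact Or.inl (mem_nbrs.2 ⟨μ, Or.inr (by rw [h, add_sub_cancel_right])⟩)
  have hkey := mem_keySet_of_uX_ne_zero_nbr hℓ hR hP hMh1 _ (cubeData_chart hP4 hc) hu hvz
  obtain ⟨hwin1, hwin2⟩ := level_window_of_mem_keySet hkey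
  have hlevw : (Dc D cq.1 cq.2).lev w.1 = (Dc D cq.1 cq.2).lev v.1 := by
    have hval := congrArg Subtype.val hvw
    simp only [blkOf_val, Prod.mk.injEq] at hval
    exact hval.1.symm
  have hspread := abs_sub_lt_of_blkOf_eq hvw
  -- `N_j = M_h·L^{j+1} ≥ 3·L^{j+1} ≥ 3·L^{lev w}`
  have hN1 : 1 ≤ (ℓ + 1) ^ cq.1 * ((ℓ + 1) * Mh) := Nat.one_le_iff_ne_zero.2 (by positivity)
  have hNM : (ℓ + 1) ^ cq.1 * ((ℓ + 1) * Mh) = bigSide ℓ Mh cq.1 := by rw [bigSide_eq]; ring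
  have hpow3 : 3 * (ℓ + 1) ^ (Dc D cq.1 cq.2).lev w.1 ≤ bigSide ℓ Mh cq.1 := by
    unfold bigSide
    calc 3 * (ℓ + 1) ^ (Dc D cq.1 cq.2).lev w.1 ≤ 3 * (ℓ + 1) ^ (cq.1 + 1) :=
          Nat.mul_le_mul_left _ (Nat.pow_le_pow_right (by omega) (by rw [hlevw]; simpa using hwin1))
      _ ≤ Mh * (ℓ + 1) ^ (cq.1 + 1) := Nat.mul_le_mul_right _ hMh
  have hpow3r : 3 * ((((ℓ + 1) ^ (Dc D cq.1 cq.2).lev w.1 : ℕ) : ℤ) : ℝ) ≤ ((bigSide ℓ Mh cq.1 : ℕ) : ℝ) := by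
    exact_mod_cast hpow3
  -- the candidate centre at `w`
  have hnear : qc ℓ k cq.1 cq.2 ∈ near (bigSide ℓ Mh cq.1) w.1 := by
    refine mem_near_of_abs_lt (one_le_bigSide hMh1 cq.1) fun ν => ?_
    have hz' : hq ((ℓ + 1) ^ cq.1) ((ℓ + 1) * Mh) (qc ℓ k cq.1 cq.2) z.1 ≠ 0 := hu
    have h := abs_lt_of_hq_ne_zero hN1 hz' ν
    rw [hNM] at h
    -- `|w_ν − z_ν| ≤ L^{lev w}`
    have hs := hspread ν
    have hwz : |((w.1 ν : ℤ) : ℝ) - ((z.1 ν : ℤ) : ℝ)| ≤ ((((ℓ + 1) ^ (Dc D cq.1 cq.2).lev w.1 : ℕ) : ℤ) : ℝ) := by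
      have hi : |w.1 ν - z.1 ν| ≤ (((ℓ + 1) ^ (Dc D cq.1 cq.2).lev w.1 : ℕ) : ℤ) := by
        rcases hzval with h0 | h0
        · rw [h0, abs_sub_comm]; exact hs.le
        · rw [h0, Pi.add_apply]
          have h1 : |w.1 ν - (v.1 ν + (Pi.single μ (1 : ℤ) : Fin (d + 1) → ℤ) ν)|
              ≤ |w.1 ν - v.1 ν| + |(Pi.single μ (1 : ℤ) : Fin (d + 1) → ℤ) ν| := by
            rw [show w.1 ν - (v.1 ν + (Pi.single μ (1 : ℤ) : Fin (d + 1) → ℤ) ν)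
              = (w.1 ν - v.1 ν) - (Pi.single μ (1 : ℤ) : Fin (d + 1) → ℤ) ν by ring]
            exact abs_sub _ _
          have h2 : |(Pi.single μ (1 : ℤ) : Fin (d + 1) → ℤ) ν| ≤ 1 := by
            by_cases hν : ν = μ
            · subst hν; simp
            · rw [Pi.single_eq_of_ne hν]; simp
          have h3 : |w.1 ν - v.1 ν| < (((ℓ + 1) ^ (Dc D cq.1 cq.2).lev w.1 : ℕ) : ℤ) := by
            rw [abs_sub_comm]; exact hs
          linarith
      rw [← Int.cast_sub]
      exact_mod_cast hi
    have e : pos w.1 ν - ((bigSide ℓ Mh cq.1 : ℕ) : ℝ) * qc ℓ k cq.1 cq.2 ν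
        = (pos z.1 ν - ((bigSide ℓ Mh cq.1 : ℕ) : ℝ) * qc ℓ k cq.1 cq.2 ν) + (((w.1 ν : ℤ) : ℝ) - ((z.1 ν : ℤ) : ℝ)) := by
      simp only [pos]; ring
    rw [e]
    refine (abs_add_le _ _).trans_lt ?_
    linarith
  exact mem_keySet (by rw [hlevw]; exact hwin1) (by rw [hlevw]; exact hwin2) hnear

end Coherence

/-! ## §2 The same-block pairs of the torus, the Hölder-weighted mixed periodic difference, the lifted fixed point -/

section Pairs

variable {ℓ Mh k R : ℕ} {P : Fin (d + 1) → ℕ}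

/-- **THE PAIRS `x ≠ x′` OF ONE BLOCK OF `𝔅` ON THE TORUS** (the two points of the Hölder quotient of `∇^η_μG′λ`,
«supp ζ ⊂ B^j(y)»; the periodic shifts `x + e_μ`, `x′ + e_μ` are always sites of the torus). [cite: Balaban1984PropagatorsII, (2.67) p.234 (the Hölder entries), p.224 (Ω₁ = T_η), dictionary] -/
structure HPairT (D : TDomains d ℓ Mh k P R) (μ : Fin (d + 1)) where
  /-- the first point -/
  x : ↥(boxDom (N0 ℓ Mh k P))
  /-- the second point -/
  x' : ↥(boxDom (N0 ℓ Mh k P))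
  /-- the points differ -/
  ne : x'.1 ≠ x.1
  /-- the points lie in one block of `𝔅` -/
  blk : blkOf D.toDomains x' = blkOf D.toDomains x

/-- pairs are determined by their two points. [folklore] -/
private theorem HPairT.ext' {D : TDomains d ℓ Mh k P R} {μ : Fin (d + 1)} {p q : HPairT D μ} (hx : p.x = q.x)
    (hx' : p.x' = q.x') : p = q := by
  cases p; cases q
  simp only at hx hx'
  subst hx hx'
  rfl

/-- finitely many pairs. [cite: Balaban1984PropagatorsII, (2.67) p.234, dictionary] -/
instance instFiniteHPairT (D : TDomains d ℓ Mh k P R) (μ : Fin (d + 1)) : Finite (HPairT D μ) :=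
  Finite.of_injective (fun p : HPairT D μ => (p.x, p.x')) fun p q h => by
    simp only [Prod.mk.injEq] at h
    exact HPairT.ext' h.1 h.2

/-- finitely many pairs. [cite: Balaban1984PropagatorsII, (2.67) p.234, dictionary] -/
noncomputable instance instFintypeHPairT (D : TDomains d ℓ Mh k P R) (μ : Fin (d + 1)) : Fintype (HPairT D μ) :=
  Fintype.ofFinite _

/-- equality of pairs is decidable (classically). [cite: Balaban1984PropagatorsII, (2.67) p.234, dictionary] -/
noncomputable instance instDecidableEqHPairT (D : TDomains d ℓ Mh k P R) (μ : Fin (d + 1)) :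
    DecidableEq (HPairT D μ) :=
  Classical.decEq _

/-- the block of a pair (that of both its points). [cite: Balaban1984PropagatorsII, p.231, dictionary] -/
def blkPT (D : TDomains d ℓ Mh k P R) (μ : Fin (d + 1)) : HPairT D μ → ↥(bset D.toDomains) :=
  fun p => blkOf D.toDomains p.x

/-- **THE HÖLDER-WEIGHTED MIXED PERIODIC DIFFERENCE OVER A PAIR** (lattice units, torus sup-distance):
`(Dd_T f)(x, x′) = |x′ − x|_T^{−α}·((f(x′+e_μ) − f(x′)) − (f(x+e_μ) − f(x)))`. [cite: Balaban1984PropagatorsII, (2.67) p.234 (fourth entry ‖ζ∇^η_xG′λ‖_α), dictionary] -/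
def DdT (D : TDomains d ℓ Mh k P R) (μ : Fin (d + 1)) (α : ℝ) :
    (↥(boxDom (N0 ℓ Mh k P)) → ℝ) →ₗ[ℝ] (HPairT D μ → ℝ) where
  toFun f p := (torusSupNorm (N0 ℓ Mh k P) (p.x'.1 - p.x.1)) ^ (-α)
    * ((f (tshift (N0 ℓ Mh k P) (unitVec μ) p.x') - f p.x') - (f (tshift (N0 ℓ Mh k P) (unitVec μ) p.x) - f p.x))
  map_add' f f' := by
    funext p
    simp only [Pi.add_apply]
    ring
  map_smul' r f := by
    funext p
    simp only [Pi.smul_apply, smul_eq_mul, RingHom.id_apply]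
    ring

/-- values of `Dd_T`. [cite: Balaban1984PropagatorsII, (2.67) p.234 (fourth entry), dictionary] -/
theorem DdT_apply (D : TDomains d ℓ Mh k P R) (μ : Fin (d + 1)) (α : ℝ) (f : ↥(boxDom (N0 ℓ Mh k P)) → ℝ)
    (p : HPairT D μ) :
    DdT D μ α f p = (torusSupNorm (N0 ℓ Mh k P) (p.x'.1 - p.x.1)) ^ (-α)
      * ((f (tshift (N0 ℓ Mh k P) (unitVec μ) p.x') - f p.x') - (f (tshift (N0 ℓ Mh k P) (unitVec μ) p.x) - f p.x)) :=
  rfl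

/-- **THE FUNCTIONAL OF THE FOURTH ENTRY ON THE TORUS** applied to a kernel `M`: `T(M) = Dd_T ∘ M`. [cite: Balaban1984PropagatorsII, (2.67) p.234 (fourth entry), dictionary] -/
def holderOpT (D : TDomains d ℓ Mh k P R) (μ : Fin (d + 1)) (α : ℝ)
    (M : Matrix ↥(boxDom (N0 ℓ Mh k P)) ↥(boxDom (N0 ℓ Mh k P)) ℝ) :
    (↥(boxDom (N0 ℓ Mh k P)) → ℝ) →ₗ[ℝ] (HPairT D μ → ℝ) :=
  DdT D μ α ∘ₗ Matrix.toLin' M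

/-- values of `holderOpT`. [cite: Balaban1984PropagatorsII, (2.67) p.234 (fourth entry), dictionary] -/
theorem holderOpT_apply (D : TDomains d ℓ Mh k P R) (μ : Fin (d + 1)) (α : ℝ)
    (M : Matrix ↥(boxDom (N0 ℓ Mh k P)) ↥(boxDom (N0 ℓ Mh k P)) ℝ) (f : ↥(boxDom (N0 ℓ Mh k P)) → ℝ)
    (p : HPairT D μ) :
    holderOpT D μ α M f p = (torusSupNorm (N0 ℓ Mh k P) (p.x'.1 - p.x.1)) ^ (-α)
      * (((M *ᵥ f) (tshift (N0 ℓ Mh k P) (unitVec μ) p.x') - (M *ᵥ f) p.x')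
        - ((M *ᵥ f) (tshift (N0 ℓ Mh k P) (unitVec μ) p.x) - (M *ᵥ f) p.x)) := by
  unfold holderOpT
  rw [LinearMap.comp_apply, Matrix.toLin'_apply, DdT_apply]

/-- `T(M + M′) = T(M) + T(M′)`. [cite: Balaban1984PropagatorsII, (2.67) p.234 (fourth entry), dictionary] -/
theorem holderOpT_add (D : TDomains d ℓ Mh k P R) (μ : Fin (d + 1)) (α : ℝ)
    (M M' : Matrix ↥(boxDom (N0 ℓ Mh k P)) ↥(boxDom (N0 ℓ Mh k P)) ℝ) :
    holderOpT D μ α (M + M') = holderOpT D μ α M + holderOpT D μ α M' := by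
  unfold holderOpT
  rw [map_add, LinearMap.comp_add]

/-- `T(M·M′) = T(M) ∘ M′`. [cite: Balaban1984PropagatorsII, (2.67) p.234 (fourth entry), dictionary] -/
theorem holderOpT_mul (D : TDomains d ℓ Mh k P R) (μ : Fin (d + 1)) (α : ℝ)
    (M M' : Matrix ↥(boxDom (N0 ℓ Mh k P)) ↥(boxDom (N0 ℓ Mh k P)) ℝ) :
    holderOpT D μ α (M * M') = holderOpT D μ α M ∘ₗ Matrix.toLin' M' := by
  unfold holderOpT
  rw [Matrix.toLin'_mul, LinearMap.comp_assoc]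

/-- **THE LIFTED FIXED POINT OF THE FOURTH ENTRY ON THE TORUS**: with `T = Dd_T∘G′`, `T₀ = Dd_T∘G′₀`:
`liftL T = liftL T₀ + liftL T · liftR R` (from `G′ = G′₀ + G′R` on `T_η`, (2.38)/(2.50)). [cite: Balaban1984PropagatorsII, (2.38) p.229, (2.50) p.232, (2.66)–(2.67) p.234] -/
theorem fixedPoint_holderT (D : TDomains d ℓ Mh k P R) {a c : ℕ → ℝ} (hℓ : 1 ≤ ℓ) (hR : 2 * (ℓ + 1) ≤ R)
    (hP : ∀ μ, 1 ≤ P μ) (hP4 : ∀ μ, 4 ≤ P μ) (hMh : 1 ≤ Mh) (ha : ∀ i, 1 ≤ i → 0 < a i)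
    (hcpos : ∀ i, 1 ≤ i → 0 < c i) (hac : ∀ i, 1 ≤ i → a (i + 1) = aNext ℓ (a i) (c i)) (μ : Fin (d + 1)) (α : ℝ) :
    liftL (holderOpT D μ α (gmlT (N0 ℓ Mh k P) ℓ k D.lev a))
      = liftL (holderOpT D μ α (gZeroT D a c hP hP4))
        + liftL (holderOpT D μ α (gmlT (N0 ℓ Mh k P) ℓ k D.lev a)) * liftR (Matrix.toLin' (rT D a c hP hP4)) := by
  have h238 := eq238_multiLevelTorus (D := D) (a := a) (c := c) hℓ hR hP hP4 hMh ha hcpos hac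
  have hGE : gmlT (N0 ℓ Mh k P) ℓ k D.lev a * mlOpT (N0 ℓ Mh k P) ℓ k D.lev a = 1 :=
    gmlT_mul_mlOpT_pos (one_le_N0 hMh hP) D.one_le_lev D.lev_le ha
  have hmat : gmlT (N0 ℓ Mh k P) ℓ k D.lev a
      = gZeroT D a c hP hP4 + gmlT (N0 ℓ Mh k P) ℓ k D.lev a * rT D a c hP hP4 := by
    have h := congrArg (fun T => gmlT (N0 ℓ Mh k P) ℓ k D.lev a * T) h238
    rw [← Matrix.mul_assoc, hGE, Matrix.one_mul, Matrix.mul_sub, Matrix.mul_one] at h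
    rw [h]; abel
  conv_lhs => rw [hmat]
  rw [holderOpT_add, holderOpT_mul, liftL_add, liftL_mul_liftR]

end Pairs

/-! ## §3 The pair-row bound of `T₀ = Dd_T∘G′₀` on the torus: every term in its chart, the sum over the cover -/

section ZeroBound

variable {ℓ Mh k R : ℕ} {P : Fin (d + 1) → ℕ}

/-- the value of a cube term vanishes where its cut-off does. [cite: Balaban1984PropagatorsII, (2.37) p.229, dictionary] -/
private theorem aX_apply_eq_zero {D' : Domains d ℓ Mh k P R} {a c : ℕ → ℝ} (hP : ∀ μ, 1 ≤ P μ)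
    (cq : ℕ × (Fin (d + 1) → ℤ)) (hc : CubeData D' cq)
    (lam : ↥(boxDom (N0 ℓ Mh k P)) → ℝ) {z : ↥(boxDom (N0 ℓ Mh k P))}
    (hz : uX (ℓ := ℓ) (Mh := Mh) (k := k) (P := P) cq z = 0) : (aX D' a c hP cq hc *ᵥ lam) z = 0 := by
  rw [aX_mulVec_apply, hz, zero_mul]

/-- **THE (2.64)-INPUT FOR THE FOURTH ENTRY, GENUINE `k`-LEVEL OPERATOR ON THE TORUS, RATE UNIFORM IN `α`**: there is
`δ₅ > 0` (function of `d`, `ℓ`, the windows) and for every `0 ≤ α < 1` an `A > 0` such that for every `k`, `M_h ≥ 3`, `R ≥ 2L`, torus size (`P_μ ≥ 4`),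
nested family `D`, weights in the windows, axis `μ`, every `λ` supported in a block `y′` with `|λ| ≤ B` and every pair
`(x, x′)` of one block `B^j(y)` of the torus:
`|x′−x|_T^{−α}·|((G′₀λ)(x′+e_μ) − (G′₀λ)(x′)) − ((G′₀λ)(x+e_μ) − (G′₀λ)(x))| ≤ A·(L^{j})^{1−α}·e^{−δ₅d_T(y,y′)/(d+1)}·|λ|`
— every transported term read in its chart over the rigidly translated pair (file 10's `aX_dd_le` on the chart family),
at most `3·2^{d+1}` of them meeting the four points. [cite: Balaban1984PropagatorsII, (2.64)–(2.66) p.234 (the G′₀ factor «(L^jη)^{1−α}» of the Hölder entry), (2.43) p.230] -/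
theorem holderZeroT_rowBound_unif (d ℓ : ℕ) (hℓ : 1 ≤ ℓ) (aminus aplus a2minus a2plus : ℝ) (ha : 0 < aminus)
    (ha2 : 0 < a2minus) :
    ∃ δ₅ : ℝ, 0 < δ₅ ∧ ∀ (α : ℝ), 0 ≤ α → α < 1 → ∃ A : ℝ, 0 < A ∧ ∀ (k Mh R : ℕ), 3 ≤ Mh → 2 * (ℓ + 1) ≤ R →
      ∀ (P : Fin (d + 1) → ℕ) (hP : ∀ μ, 1 ≤ P μ) (hP4 : ∀ μ, 4 ≤ P μ) (D : TDomains d ℓ Mh k P R) (a c : ℕ → ℝ),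
        (∀ i, 1 ≤ i → aminus ≤ a i ∧ a i ≤ aplus) → (∀ i, 1 ≤ i → a2minus ≤ c i ∧ c i ≤ a2plus) →
        ∀ (μ : Fin (d + 1)) (y' : ↥(bset D.toDomains)) (lam : ↥(boxDom (N0 ℓ Mh k P)) → ℝ) (B : ℝ),
          BlockSupp (g := geomT D) (blkOf D.toDomains) lam y' B → ∀ p : HPairT D μ,
          |holderOpT D μ α (gZeroT D a c hP hP4) lam p|
            ≤ A * (((ℓ : ℝ) + 1) ^ (blkPT D μ p).1.1) ^ (1 - α)
              * Real.exp (-(δ₅ / (d + 1) * (geomT D).dist (blkPT D μ p) y')) * B := by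
  obtain ⟨δ₄, hδ₄, hQA⟩ := aX_dd_le_unif d ℓ hℓ aminus aplus a2minus a2plus ha ha2
  refine ⟨δ₄, hδ₄, fun α hα0 hα1 => ?_⟩
  obtain ⟨Q, hQ, hbox⟩ := hQA α hα0 hα1
  refine ⟨3 * 2 ^ (d + 1) * Q + 1, by positivity, ?_⟩
  intro k Mh R hMh hR P hP hP4 D a c haw hcw μ y' lam B hlam p
  have hMh1 : 1 ≤ Mh := le_trans (by norm_num) hMh
  have hB0 : 0 ≤ B := hlam.nonneg
  have hlev : (blkPT D μ p).1.1 = D.lev p.x.1 := rfl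
  have hblkP : blkPT D μ p = blkOf D.toDomains p.x := rfl
  rw [hlev, hblkP]
  set dist0 : ℝ := (((bondT D).dist (blkOf D.toDomains p.x) y' : ℕ) : ℝ) with hdist0
  have hgeom : (geomT D).dist (blkOf D.toDomains p.x) y' = dist0 := rfl
  rw [hgeom]
  obtain ⟨E4, hE4⟩ : ∃ t : ℝ, t = Real.exp (-(δ₄ / (d + 1) * dist0)) := ⟨_, rfl⟩
  obtain ⟨LJ, hLJ⟩ : ∃ t : ℝ, t = (((ℓ : ℝ) + 1) ^ D.lev p.x.1) ^ (1 - α) := ⟨_, rfl⟩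
  rw [← hE4, ← hLJ]
  have hE40 : 0 ≤ E4 := by rw [hE4]; exact (Real.exp_pos _).le
  have hLJ0 : 0 ≤ LJ := by rw [hLJ]; exact Real.rpow_nonneg (by positivity) _
  -- the weight: the torus distance of the pair is its lattice distance
  have hWeq : torusSupNorm (N0 ℓ Mh k P) (p.x'.1 - p.x.1) = supNorm (p.x'.1 - p.x.1) :=
    torusSupNorm_sub_of_blkOf hMh1 hP4 p.blk
  have hs0 : 0 < supNorm (p.x'.1 - p.x.1) :=
    lt_of_lt_of_le one_pos (B4StripSumsHolder.one_le_supNorm (sub_ne_zero.2 p.ne))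
  have hW0 : 0 ≤ (supNorm (p.x'.1 - p.x.1)) ^ (-α) := Real.rpow_nonneg hs0.le _
  -- the unit vector
  have hue : (unitVec μ : Fin (d + 1) → ℤ) = Pi.single μ 1 := rfl
  -- one term
  obtain ⟨E, hE⟩ : ∃ t : ℝ, t = LJ * (Q * E4 * B) := ⟨_, rfl⟩
  have hEnn : 0 ≤ E := by rw [hE]; positivity
  have hone : ∀ (cq : ℕ × (Fin (d + 1) → ℤ)) (hc : CubeDataT D cq),
      |(supNorm (p.x'.1 - p.x.1)) ^ (-α)
        * (((aT D a c hP hP4 cq hc *ᵥ lam) (tshift (N0 ℓ Mh k P) (unitVec μ) p.x') - (aT D a c hP hP4 cq hc *ᵥ lam) p.x')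
          - ((aT D a c hP hP4 cq hc *ᵥ lam) (tshift (N0 ℓ Mh k P) (unitVec μ) p.x)
            - (aT D a c hP hP4 cq hc *ᵥ lam) p.x))| ≤ E := by
    intro cq hc
    -- the chart of the cube, the translated data
    set σ := σc ℓ Mh k P cq.1 cq.2 with hσ
    set w : ↥(boxDom (N0 ℓ Mh k P)) := σ.symm p.x with hw
    set w' : ↥(boxDom (N0 ℓ Mh k P)) := σ.symm p.x' with hw'
    have hcc := cubeData_chart (D := D) hP4 hc
    obtain ⟨b, hb⟩ := blkMap_surjective (D := D) hMh1 hP (svec ℓ k cq.1 cq.2) y'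
    have hlam' : BlockSupp (g := geom (Dc D cq.1 cq.2)) (blkOf (Dc D cq.1 cq.2)) (lam ∘ σ) b B :=
      blockSupp_chart hMh1 hP (svec ℓ k cq.1 cq.2) hlam hb
    -- the four values in the chart
    have hv : ∀ z, (aT D a c hP hP4 cq hc *ᵥ lam) z
        = (aX (Dc D cq.1 cq.2) a c hP (cq.1, qc ℓ k cq.1 cq.2) hcc *ᵥ (lam ∘ σ)) (σ.symm z) := by
      intro z; unfold aT; rw [reindex_mulVec_apply]
    have hse : ∀ z, σ.symm (tshift (N0 ℓ Mh k P) (unitVec μ) z) = tshift (N0 ℓ Mh k P) (unitVec μ) (σ.symm z) :=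
      fun z => σc_symm_tshift cq.1 cq.2 (unitVec μ) z
    rw [hv, hv, hv, hv, hse, hse]
    -- the pair in the chart: same block, rigid difference
    have hblkc : blkOf (Dc D cq.1 cq.2) w' = blkOf (Dc D cq.1 cq.2) w := by
      apply blkMap_injective (D := D) hMh1 hP (svec ℓ k cq.1 cq.2)
      unfold Dc
      rw [blkMap_blkOf hMh1 hP, blkMap_blkOf hMh1 hP, hw, hw', hσ]
      unfold σc
      rw [Equiv.apply_symm_apply, Equiv.apply_symm_apply]
      exact p.blk
    have hdiff : w'.1 - w.1 = p.x'.1 - p.x.1 := by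
      rw [hw, hw', hσ]; exact σc_symm_sub_of_blkOf hMh1 hP cq.1 cq.2 p.blk
    have hne : w'.1 ≠ w.1 := fun h0 => p.ne (sub_eq_zero.1 (by rw [← hdiff, h0, sub_self]))
    -- the case that the term misses the four points
    by_cases hall : uX (ℓ := ℓ) (Mh := Mh) (k := k) (P := P) (cq.1, qc ℓ k cq.1 cq.2) w = 0 ∧
        uX (ℓ := ℓ) (Mh := Mh) (k := k) (P := P) (cq.1, qc ℓ k cq.1 cq.2) (tshift (N0 ℓ Mh k P) (unitVec μ) w) = 0 ∧
        uX (ℓ := ℓ) (Mh := Mh) (k := k) (P := P) (cq.1, qc ℓ k cq.1 cq.2) w' = 0 ∧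
        uX (ℓ := ℓ) (Mh := Mh) (k := k) (P := P) (cq.1, qc ℓ k cq.1 cq.2) (tshift (N0 ℓ Mh k P) (unitVec μ) w') = 0
    · obtain ⟨h1, h2, h3, h4⟩ := hall
      rw [← hw, ← hw', aX_apply_eq_zero hP _ hcc _ h1, aX_apply_eq_zero hP _ hcc _ h2,
        aX_apply_eq_zero hP _ hcc _ h3, aX_apply_eq_zero hP _ hcc _ h4]
      simp only [sub_self, mul_zero, abs_zero]
      exact hEnn
    -- otherwise the four chart points lie in the chart box
    have hsome : ∃ v z : ↥(boxDom (N0 ℓ Mh k P)), (v = w ∨ v = w') ∧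
        (z = v ∨ z = tshift (N0 ℓ Mh k P) (unitVec μ) v) ∧
        uX (ℓ := ℓ) (Mh := Mh) (k := k) (P := P) (cq.1, qc ℓ k cq.1 cq.2) z ≠ 0 := by
      simp only [not_and_or] at hall
      rcases hall with h | h | h | h
      · exact ⟨w, w, Or.inl rfl, Or.inl rfl, h⟩
      · exact ⟨w, _, Or.inl rfl, Or.inr rfl, h⟩
      · exact ⟨w', w', Or.inr rfl, Or.inl rfl, h⟩
      · exact ⟨w', _, Or.inr rfl, Or.inr rfl, h⟩
    obtain ⟨v, z, hv0, hz0, hu⟩ := hsome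
    have hvw : blkOf (Dc D cq.1 cq.2) v = blkOf (Dc D cq.1 cq.2) w := by
      rcases hv0 with h0 | h0
      · rw [h0]
      · rw [h0]; exact hblkc
    have hvw' : blkOf (Dc D cq.1 cq.2) v = blkOf (Dc D cq.1 cq.2) w' := by
      rcases hv0 with h0 | h0
      · rw [h0]; exact hblkc.symm
      · rw [h0]
    have hwe : w.1 + Pi.single μ 1 ∈ boxDom (N0 ℓ Mh k P) :=
      add_unit_mem_of_uX_ne_zero hℓ hR hP hP4 hMh1 hc μ hvw hz0 hu
    have hwe' : w'.1 + Pi.single μ 1 ∈ boxDom (N0 ℓ Mh k P) :=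
      add_unit_mem_of_uX_ne_zero hℓ hR hP hP4 hMh1 hc μ hvw' hz0 hu
    have hte : tshift (N0 ℓ Mh k P) (unitVec μ) w = ⟨w.1 + Pi.single μ 1, hwe⟩ :=
      Subtype.ext (by rw [tshift_val_of_mem (by rw [hue]; exact hwe), hue])
    have hte' : tshift (N0 ℓ Mh k P) (unitVec μ) w' = ⟨w'.1 + Pi.single μ 1, hwe'⟩ :=
      Subtype.ext (by rw [tshift_val_of_mem (by rw [hue]; exact hwe'), hue])
    rw [← hw, ← hw', hte, hte', ← hdiff]
    -- file 10's pair bound on the chart family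
    have h := hbox k Mh R hMh hR P hP (Dc D cq.1 cq.2) a c haw hcw μ b (lam ∘ σ) B hlam' w w' hne hblkc hwe hwe'
      (cq.1, qc ℓ k cq.1 cq.2) hcc
    rw [abs_mul, abs_of_nonneg (by rw [hdiff]; exact hW0)]
    refine h.trans ?_
    -- the level, the distance
    have hlevc : (Dc D cq.1 cq.2).lev w.1 = D.lev p.x.1 := by rw [hw, hσ]; exact Dc_lev_symm D cq.1 cq.2 p.x
    rw [hlevc, ← hLJ, hE]
    have hd : dist0 ≤ (((bond (Dc D cq.1 cq.2)).dist (blkOf (Dc D cq.1 cq.2) w) b : ℕ) : ℝ) := by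
      rw [hdist0, ← hb, hw, hσ]
      exact_mod_cast distT_blkOf_le_chart hMh1 hP (svec ℓ k cq.1 cq.2) p.x b
    have hexp : Real.exp (-(δ₄ / (d + 1) * (geom (Dc D cq.1 cq.2)).dist (blkOf (Dc D cq.1 cq.2) w) b)) ≤ E4 := by
      rw [hE4, Real.exp_le_exp, neg_le_neg_iff]
      exact mul_le_mul_of_nonneg_left hd (by positivity)
    have : Q * Real.exp (-(δ₄ / (d + 1) * (geom (Dc D cq.1 cq.2)).dist (blkOf (Dc D cq.1 cq.2) w) b)) * B
        ≤ Q * E4 * B :=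
      mul_le_mul_of_nonneg_right (mul_le_mul_of_nonneg_left hexp hQ.le) hB0
    exact mul_le_mul_of_nonneg_left this hLJ0
  -- the sum over the cover
  rw [holderOpT_apply, hWeq]
  unfold gZeroT
  rw [Matrix.sum_mulVec, Finset.sum_apply, Finset.sum_apply, Finset.sum_apply, Finset.sum_apply,
    ← Finset.sum_sub_distrib, ← Finset.sum_sub_distrib, ← Finset.sum_sub_distrib, Finset.mul_sum, Finset.attach_eq_univ]
  refine (Finset.abs_sum_le_sum_abs _ _).trans ?_
  -- the members with a non-zero term are keyed at `x`
  have key := sum_le_card_mul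
    (fun cq : {cq // cq ∈ cubeSetT D} => |(supNorm (p.x'.1 - p.x.1)) ^ (-α)
        * (((aT D a c hP hP4 cq.1 (cubeDataT_of_mem cq.2) *ᵥ lam) (tshift (N0 ℓ Mh k P) (unitVec μ) p.x')
            - (aT D a c hP hP4 cq.1 (cubeDataT_of_mem cq.2) *ᵥ lam) p.x')
          - ((aT D a c hP hP4 cq.1 (cubeDataT_of_mem cq.2) *ᵥ lam) (tshift (N0 ℓ Mh k P) (unitVec μ) p.x)
            - (aT D a c hP hP4 cq.1 (cubeDataT_of_mem cq.2) *ᵥ lam) p.x))|)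
    (fun cq => (cq.1.1, Qmap ℓ Mh k P cq.1.1 p.x.1 cq.1.2)) (keyT_injective D p.x.1) (keySet ℓ Mh (D.lev p.x.1) p.x.1)
    (fun cq hq0 => by
      -- a non-zero term: `h_□ ≠ 0` at one of the four chart points, hence keyed at `x`
      have hcc := cubeData_chart (D := D) hP4 (cubeDataT_of_mem cq.2)
      set σ := σc ℓ Mh k P cq.1.1 cq.1.2 with hσ
      set w : ↥(boxDom (N0 ℓ Mh k P)) := σ.symm p.x with hw
      set w' : ↥(boxDom (N0 ℓ Mh k P)) := σ.symm p.x' with hw'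
      have hblkc : blkOf (Dc D cq.1.1 cq.1.2) w' = blkOf (Dc D cq.1.1 cq.1.2) w := by
        apply blkMap_injective (D := D) hMh1 hP (svec ℓ k cq.1.1 cq.1.2)
        unfold Dc
        rw [blkMap_blkOf hMh1 hP, blkMap_blkOf hMh1 hP, hw, hw', hσ]
        unfold σc
        rw [Equiv.apply_symm_apply, Equiv.apply_symm_apply]
        exact p.blk
      by_contra hmem
      apply hq0
      have hv : ∀ z, (aT D a c hP hP4 cq.1 (cubeDataT_of_mem cq.2) *ᵥ lam) z
          = (aX (Dc D cq.1.1 cq.1.2) a c hP (cq.1.1, qc ℓ k cq.1.1 cq.1.2) hcc *ᵥ (lam ∘ σ)) (σ.symm z) := by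
        intro z; unfold aT; rw [reindex_mulVec_apply]
      have hse : ∀ z, σ.symm (tshift (N0 ℓ Mh k P) (unitVec μ) z) = tshift (N0 ℓ Mh k P) (unitVec μ) (σ.symm z) :=
        fun z => σc_symm_tshift cq.1.1 cq.1.2 (unitVec μ) z
      have hzero : ∀ v z : ↥(boxDom (N0 ℓ Mh k P)), (v = w ∨ v = w') →
          (z = v ∨ z = tshift (N0 ℓ Mh k P) (unitVec μ) v) →
          uX (ℓ := ℓ) (Mh := Mh) (k := k) (P := P) (cq.1.1, qc ℓ k cq.1.1 cq.1.2) z = 0 := by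
        intro v z hv0 hz0
        by_contra hu
        have hvw : blkOf (Dc D cq.1.1 cq.1.2) v = blkOf (Dc D cq.1.1 cq.1.2) w := by
          rcases hv0 with h0 | h0
          · rw [h0]
          · rw [h0]; exact hblkc
        have hk := mem_keySet_of_uX_pair hℓ hR hP hP4 hMh (cubeDataT_of_mem cq.2) μ hvw hz0 hu
        have hlevc : (Dc D cq.1.1 cq.1.2).lev w.1 = D.lev p.x.1 := by
          rw [hw, hσ]; exact Dc_lev_symm D cq.1.1 cq.1.2 p.x
        rw [hlevc, hw, hσ] at hk
        exact hmem (mem_keySet_chart hMh1 (cubeDataT_of_mem cq.2).hj.2 hk)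
      rw [hv, hv, hv, hv, hse, hse, ← hw, ← hw',
        aX_apply_eq_zero hP _ hcc _ (hzero w w (Or.inl rfl) (Or.inl rfl)),
        aX_apply_eq_zero hP _ hcc _ (hzero w _ (Or.inl rfl) (Or.inr rfl)),
        aX_apply_eq_zero hP _ hcc _ (hzero w' w' (Or.inr rfl) (Or.inl rfl)),
        aX_apply_eq_zero hP _ hcc _ (hzero w' _ (Or.inr rfl) (Or.inr rfl))]
      simp only [sub_self, mul_zero, abs_zero])
    hEnn (fun cq => hone cq.1 (cubeDataT_of_mem cq.2))
  refine key.trans ?_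
  have hcard : ((keySet ℓ Mh (D.lev p.x.1) p.x.1).card : ℝ) ≤ 3 * 2 ^ (d + 1) := by
    exact_mod_cast card_keySet_le _ _ _ _
  calc ((keySet ℓ Mh (D.lev p.x.1) p.x.1).card : ℝ) * E ≤ 3 * 2 ^ (d + 1) * E :=
        mul_le_mul_of_nonneg_right hcard hEnn
    _ = 3 * 2 ^ (d + 1) * Q * LJ * E4 * B := by rw [hE]; ring
    _ ≤ (3 * 2 ^ (d + 1) * Q + 1) * LJ * E4 * B := by
        have : 0 ≤ LJ * E4 * B := by positivity
        nlinarith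

/-- the same at a fixed `α` (the per-`α` form consumed by §4's per-`α` statement). [cite: Balaban1984PropagatorsII, (2.64)–(2.66) p.234, (2.43) p.230] -/
theorem holderZeroT_rowBound (d ℓ : ℕ) (hℓ : 1 ≤ ℓ) (aminus aplus a2minus a2plus : ℝ) (ha : 0 < aminus)
    (ha2 : 0 < a2minus) (α : ℝ) (hα0 : 0 ≤ α) (hα1 : α < 1) :
    ∃ δ₅ A : ℝ, 0 < δ₅ ∧ 0 < A ∧ ∀ (k Mh R : ℕ), 3 ≤ Mh → 2 * (ℓ + 1) ≤ R →
      ∀ (P : Fin (d + 1) → ℕ) (hP : ∀ μ, 1 ≤ P μ) (hP4 : ∀ μ, 4 ≤ P μ) (D : TDomains d ℓ Mh k P R) (a c : ℕ → ℝ),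
        (∀ i, 1 ≤ i → aminus ≤ a i ∧ a i ≤ aplus) → (∀ i, 1 ≤ i → a2minus ≤ c i ∧ c i ≤ a2plus) →
        ∀ (μ : Fin (d + 1)) (y' : ↥(bset D.toDomains)) (lam : ↥(boxDom (N0 ℓ Mh k P)) → ℝ) (B : ℝ),
          BlockSupp (g := geomT D) (blkOf D.toDomains) lam y' B → ∀ p : HPairT D μ,
          |holderOpT D μ α (gZeroT D a c hP hP4) lam p|
            ≤ A * (((ℓ : ℝ) + 1) ^ (blkPT D μ p).1.1) ^ (1 - α)
              * Real.exp (-(δ₅ / (d + 1) * (geomT D).dist (blkPT D μ p) y')) * B := by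
  obtain ⟨δ₅, hδ₅, h⟩ := holderZeroT_rowBound_unif d ℓ hℓ aminus aplus a2minus a2plus ha ha2
  obtain ⟨A, hA, h'⟩ := h α hα0 hα1
  exact ⟨δ₅, A, hδ₅, hA, h'⟩

end ZeroBound

/-! ## §4 Proposition 2.2, fourth entry, for the genuine `k`-level operator on the torus -/

section Prop22

variable {ℓ Mh k R : ℕ} {P : Fin (d + 1) → ℕ}

/-- **THE LIFTED FOURTH ENTRY HAS A MAJORANT** `C_α·(L^{j})^{1−α}·e^{−½δ₀d_T(y,y′)}` on `𝔅` (pairs of `B^j(y)` as rows),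
for the genuine `k`-level operator on the torus, WITH ONE RATE AND ONE THRESHOLD FOR ALL `α`: there are `δ₀, M₀ > 0`,
`N₀ ≥ 1` (functions of `d`, `ℓ`, the windows) and for every `0 ≤ α < 1` a `C_α > 0` such that for every `k`, `M_h ≥ 3` with `L·M_h ≥ M₀`, `R ≥ 2L` with `RM ≥ N₀ + 1`, torus size
(`P_μ ≥ 4`), nested family `D`, weights in the windows with `a_{i+1} = aNext ℓ a_i c_i` and axis `μ`, the lift of
`T = Dd_T∘G′` (`G′ = Δ′_a^{−1}` on `T_η`) has that majorant — the lifted fixed point `T = T₀ + T·R` (§2), the majorants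
of `R` ((2.64) on `T_η`, file T4) and of `T₀` (§3), Lemma 2.1 on the torus (file T3) and the chain (2.64)–(2.66) on
`pairs ⊕ sites`. [cite: Balaban1984PropagatorsII, Proposition 2.2 (2.67) p.234 (fourth entry), (2.64)–(2.66) p.234, p.224 (Ω₁ = T_η admitted)] -/
theorem hasMajorant_holder_multiLevelTorus_unif (d ℓ : ℕ) (hℓ : 1 ≤ ℓ) (aminus aplus a2minus a2plus : ℝ)
    (ha : 0 < aminus) (ha2 : 0 < a2minus) :
    ∃ δ₀ M₀ : ℝ, ∃ N₀ : ℕ, 0 < δ₀ ∧ 0 < M₀ ∧ 0 < N₀ ∧ ∀ (α : ℝ), 0 ≤ α → α < 1 → ∃ C : ℝ, 0 < C ∧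
      ∀ (k Mh R : ℕ), 3 ≤ Mh → M₀ ≤ ((ℓ : ℝ) + 1) * Mh → 2 * (ℓ + 1) ≤ R → N₀ + 1 ≤ R * ((ℓ + 1) * Mh) →
      ∀ (P : Fin (d + 1) → ℕ) (hP : ∀ μ, 1 ≤ P μ) (hP4 : ∀ μ, 4 ≤ P μ) (D : TDomains d ℓ Mh k P R) (a c : ℕ → ℝ),
        (∀ i, 1 ≤ i → aminus ≤ a i ∧ a i ≤ aplus) → (∀ i, 1 ≤ i → a2minus ≤ c i ∧ c i ≤ a2plus) →
        (∀ i, 1 ≤ i → a (i + 1) = aNext ℓ (a i) (c i)) → ∀ μ : Fin (d + 1),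
        HasMajorant (g := geomT D) (Sum.elim (blkPT D μ) (blkOf D.toDomains))
          (liftL (holderOpT D μ α (gmlT (N0 ℓ Mh k P) ℓ k D.lev a)))
          (fun y y' => C * (((ℓ : ℝ) + 1) ^ y.1.1) ^ (1 - α) * Real.exp (-(δ₀ / 2 * (geomT D).dist y y'))) := by
  obtain ⟨δ₁, K, hδ₁, hK, hRmaj⟩ := rT_majorant d ℓ hℓ aminus aplus a2minus a2plus ha ha2
  obtain ⟨δ₂, hδ₂, hGrowA⟩ := holderZeroT_rowBound_unif d ℓ hℓ aminus aplus a2minus a2plus ha ha2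
  have hL0 : (0 : ℝ) < (ℓ : ℝ) + 1 := by positivity
  have hL1 : (1 : ℝ) ≤ (ℓ : ℝ) + 1 := by linarith [(Nat.cast_nonneg ℓ : (0 : ℝ) ≤ ℓ)]
  -- the rate `δ₀ = min(δ₁, δ₂)/(d+1)` and the (2.59)-threshold `N₀`
  set δ₀ : ℝ := min δ₁ δ₂ / (d + 1) with hδ₀
  have hδ₀pos : 0 < δ₀ := by rw [hδ₀]; exact div_pos (lt_min hδ₁ hδ₂) (by positivity)
  set N₀ : ℕ := ⌈4 * ((d : ℝ) + 1) * ((ℓ : ℝ) + 1) / (1 / 2 * δ₀)⌉₊ + 1 with hN₀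
  have hN₀pos : 0 < N₀ := by rw [hN₀]; omega
  have hθlt : Real.exp (-(1 / 2 * δ₀)) * ((ℓ : ℝ) + 1) ^ ((2 * (d + 1 : ℕ) : ℝ) / N₀) < 1 := by
    refine theta_lt_one_of_log hL0 hN₀pos ?_
    have hlog : Real.log ((ℓ : ℝ) + 1) ≤ (ℓ : ℝ) + 1 := (Real.log_le_sub_one_of_pos hL0).trans (by linarith)
    have hN₀ge : 4 * ((d : ℝ) + 1) * ((ℓ : ℝ) + 1) / (1 / 2 * δ₀) < (N₀ : ℝ) := by
      rw [hN₀]; push_cast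
      exact lt_of_le_of_lt (Nat.le_ceil _) (by linarith)
    have hσ : (0 : ℝ) < 1 / 2 * δ₀ := by positivity
    rw [div_lt_iff₀ hσ] at hN₀ge
    push_cast
    nlinarith [mul_nonneg (by positivity : (0 : ℝ) ≤ 2 * ((d : ℝ) + 1)) (Real.log_nonneg hL1)]
  -- the (2.61)-constant and «M sufficiently large»
  set cK : ℝ := K261 N₀ (d + 1) ((ℓ : ℝ) + 1) 1 (1 / 2 * δ₀) with hcK
  have hcK0 : 0 ≤ cK := K261_nonneg (by positivity) zero_le_one
  set M₀ : ℝ := 2 * K * cK + 1 with hM₀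
  refine ⟨δ₀, M₀, N₀, hδ₀pos, by positivity, hN₀pos, fun α hα0 hα1 => ?_⟩
  obtain ⟨A, hA, hGrow⟩ := hGrowA α hα0 hα1
  refine ⟨2 * A * cK + 1, by positivity, ?_⟩
  intro k Mh R hMh hM hR hRM P hP hP4 D a c haw hcw hac μ
  have hMh1 : 1 ≤ Mh := le_trans (by norm_num) hMh
  have hMpos : (0 : ℝ) < ((ℓ : ℝ) + 1) * Mh := by
    have : (1 : ℝ) ≤ Mh := by exact_mod_cast hMh1
    positivity
  -- the majorants of the lifted `R` and of the lifted `T₀`, at the common rate `δ₀`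
  set θ : ℝ := K / (((ℓ : ℝ) + 1) * Mh) with hθ
  have hθ0 : 0 ≤ θ := by positivity
  have hdnn : ∀ y y' : (geomT D).Site, 0 ≤ (geomT D).dist y y' := (triangle_refl_nonneg_T D hMh1 hP).2.2
  have hrate : ∀ (δ : ℝ), min δ₁ δ₂ ≤ δ → ∀ y y' : (geomT D).Site,
      Real.exp (-(δ / (d + 1) * (geomT D).dist y y')) ≤ Real.exp (-(δ₀ * (geomT D).dist y y')) := by
    intro δ hδ y y'
    rw [Real.exp_le_exp, hδ₀, neg_le_neg_iff]
    exact mul_le_mul_of_nonneg_right (div_le_div_of_nonneg_right hδ (by positivity)) (hdnn y y')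
  have hRm0 : HasMajorant (g := geomT D) (blkOf D.toDomains) (Matrix.toLin' (rT D a c hP hP4))
      (fun y y' => θ * Real.exp (-(δ₀ * (geomT D).dist y y'))) :=
    hasMajorant_mono (blkOf D.toDomains) (hRmaj k Mh R hMh hR P hP hP4 D a c haw hcw) fun y y' =>
      mul_le_mul_of_nonneg_left (hrate δ₁ (min_le_left _ _) y y') hθ0
  have hRm : HasMajorant (g := geomT D) (Sum.elim (blkPT D μ) (blkOf D.toDomains))
      (liftR (Y := HPairT D μ) (Matrix.toLin' (rT D a c hP hP4)))
      (fun y y' => θ * Real.exp (-(δ₀ * (geomT D).dist y y'))) :=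
    hasMajorant_liftR (g := geomT D) (blkOf D.toDomains) (blkPT D μ)
      (K := fun y y' => θ * Real.exp (-(δ₀ * (geomT D).dist y y'))) (fun y y' => by positivity) hRm0
  have hGm : HasMajorant (g := geomT D) (Sum.elim (blkPT D μ) (blkOf D.toDomains))
      (liftL (holderOpT D μ α (gZeroT D a c hP hP4)))
      (fun y y' => A * (((ℓ : ℝ) + 1) ^ y.1.1) ^ (1 - α) * Real.exp (-(δ₀ * (geomT D).dist y y'))) := by
    refine hasMajorant_liftL (g := geomT D) (blkOf D.toDomains) (blkPT D μ)
      (K := fun y y' => A * (((ℓ : ℝ) + 1) ^ y.1.1) ^ (1 - α) * Real.exp (-(δ₀ * (geomT D).dist y y')))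
      (fun y y' => by positivity) fun y' lam B hlam p => ?_
    refine (hGrow k Mh R hMh hR P hP hP4 D a c haw hcw μ y' lam B hlam p).trans ?_
    refine mul_le_mul_of_nonneg_right ?_ hlam.nonneg
    exact mul_le_mul_of_nonneg_left (hrate δ₂ (min_le_right _ _) _ _) (by positivity)
  -- Lemma 2.1 on the torus with `α′ = ½`
  obtain ⟨-, h261, -, h263⟩ := lemma21_torus D hMh1 hP hN₀pos hRM hδ₀pos.le (α := 1 / 2) (by norm_num)
    (by norm_num) hθlt
  obtain ⟨htri, hrefl, -⟩ := triangle_refl_nonneg_T D hMh1 hP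
  -- the smallness `θ·c < 1` from `M ≥ M₀`
  have hsmall : θ * cK ≤ 1 / 2 := by
    rw [hθ, div_mul_eq_mul_div, div_le_iff₀ hMpos]
    have : 2 * K * cK + 1 ≤ ((ℓ : ℝ) + 1) * Mh := hM
    nlinarith
  have hsmall' : θ * cK < 1 := by linarith
  -- the lifted fixed point and the chain on `pairs ⊕ sites`
  have hfix := fixedPoint_holderT D (c := c) hℓ hR hP hP4 hMh1 (fun i hi => lt_of_lt_of_le ha (haw i hi).1)
    (fun i hi => lt_of_lt_of_le ha2 (hcw i hi).1) hac μ α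
  have hchain := majorant_of_fixedPoint_266W (g := geomT D) (Sum.elim (blkPT D μ) (blkOf D.toDomains)) cK δ₀ (1 / 2)
    θ A (fun y => (((ℓ : ℝ) + 1) ^ y.1.1) ^ (1 - α)) hA.le (fun y => Real.rpow_nonneg (by positivity) _) hθ0 hcK0
    (by nlinarith [hδ₀pos.le] : (0 : ℝ) ≤ (1 - 1 / 2) * δ₀) htri hrefl hdnn h261 h263 hsmall' hGm hRm hfix
  refine hasMajorant_mono (g := geomT D) (Sum.elim (blkPT D μ) (blkOf D.toDomains)) hchain fun y y' => ?_
  have hinv : (1 - θ * cK)⁻¹ ≤ 2 := by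
    rw [inv_le_comm₀ (by linarith) (by norm_num)]; linarith
  have hexp0 : 0 ≤ Real.exp (-((1 - 1 / 2) * δ₀ * (geomT D).dist y y')) := (Real.exp_pos _).le
  have hP0 : 0 ≤ (((ℓ : ℝ) + 1) ^ y.1.1) ^ (1 - α) := Real.rpow_nonneg (by positivity) _
  have hrate2 : Real.exp (-((1 - 1 / 2) * δ₀ * (geomT D).dist y y')) = Real.exp (-(δ₀ / 2 * (geomT D).dist y y')) := by
    congr 1; ring
  rw [← hrate2]
  have h1 : A * cK * (1 - θ * cK)⁻¹ ≤ 2 * A * cK + 1 := by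
    have : A * cK * (1 - θ * cK)⁻¹ ≤ A * cK * 2 := mul_le_mul_of_nonneg_left hinv (by positivity)
    linarith
  calc A * cK * (1 - θ * cK)⁻¹ * (((ℓ : ℝ) + 1) ^ y.1.1) ^ (1 - α) * Real.exp (-((1 - 1 / 2) * δ₀ * (geomT D).dist y y'))
      = A * cK * (1 - θ * cK)⁻¹
        * ((((ℓ : ℝ) + 1) ^ y.1.1) ^ (1 - α) * Real.exp (-((1 - 1 / 2) * δ₀ * (geomT D).dist y y'))) := by ring
    _ ≤ (2 * A * cK + 1) * ((((ℓ : ℝ) + 1) ^ y.1.1) ^ (1 - α) * Real.exp (-((1 - 1 / 2) * δ₀ * (geomT D).dist y y'))) :=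
        mul_le_mul_of_nonneg_right h1 (mul_nonneg hP0 hexp0)
    _ = (2 * A * cK + 1) * (((ℓ : ℝ) + 1) ^ y.1.1) ^ (1 - α) * Real.exp (-((1 - 1 / 2) * δ₀ * (geomT D).dist y y')) := by
        ring

/-- the same at a fixed `α` (the per-`α` form). [cite: Balaban1984PropagatorsII, Proposition 2.2 (2.67) p.234 (fourth entry), (2.64)–(2.66) p.234] -/
theorem hasMajorant_holder_multiLevelTorus (d ℓ : ℕ) (hℓ : 1 ≤ ℓ) (aminus aplus a2minus a2plus : ℝ) (ha : 0 < aminus)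
    (ha2 : 0 < a2minus) (α : ℝ) (hα0 : 0 ≤ α) (hα1 : α < 1) :
    ∃ δ₀ C M₀ : ℝ, ∃ N₀ : ℕ, 0 < δ₀ ∧ 0 < C ∧ 0 < M₀ ∧ 0 < N₀ ∧
      ∀ (k Mh R : ℕ), 3 ≤ Mh → M₀ ≤ ((ℓ : ℝ) + 1) * Mh → 2 * (ℓ + 1) ≤ R → N₀ + 1 ≤ R * ((ℓ + 1) * Mh) →
      ∀ (P : Fin (d + 1) → ℕ) (hP : ∀ μ, 1 ≤ P μ) (hP4 : ∀ μ, 4 ≤ P μ) (D : TDomains d ℓ Mh k P R) (a c : ℕ → ℝ),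
        (∀ i, 1 ≤ i → aminus ≤ a i ∧ a i ≤ aplus) → (∀ i, 1 ≤ i → a2minus ≤ c i ∧ c i ≤ a2plus) →
        (∀ i, 1 ≤ i → a (i + 1) = aNext ℓ (a i) (c i)) → ∀ μ : Fin (d + 1),
        HasMajorant (g := geomT D) (Sum.elim (blkPT D μ) (blkOf D.toDomains))
          (liftL (holderOpT D μ α (gmlT (N0 ℓ Mh k P) ℓ k D.lev a)))
          (fun y y' => C * (((ℓ : ℝ) + 1) ^ y.1.1) ^ (1 - α) * Real.exp (-(δ₀ / 2 * (geomT D).dist y y'))) := by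
  obtain ⟨δ₀, M₀, N₀, hδ₀, hM₀, hN₀, h⟩ :=
    hasMajorant_holder_multiLevelTorus_unif d ℓ hℓ aminus aplus a2minus a2plus ha ha2
  obtain ⟨C, hC, h'⟩ := h α hα0 hα1
  exact ⟨δ₀, C, M₀, N₀, hδ₀, hC, hM₀, hN₀, h'⟩

/-- **[B6] PROPOSITION 2.2, FOURTH ENTRY OF (2.67) (`‖ζ∇^η_xG′λ‖_α`), FOR THE GENUINE `k`-LEVEL OPERATOR
`G′ = Δ′_a^{−1}` ON THE TORUS `T_η`, ONE RATE AND ONE THRESHOLD FOR ALL `α`** (print's carrier, `Ω₁ = T_η`): there are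
`δ₀, M₀ > 0` and `N₀ ≥ 1` (functions of `d`, `ℓ`, the windows — NOT of the torus, NOT of `α`) and for every `0 ≤ α < 1`
a `C_α > 0` such that for EVERY number of levels `k`, `M_h ≥ 3` with `L·M_h ≥ M₀` («M is sufficiently large»), `R ≥ 2L`
with `RM ≥ N₀ + 1` ((2.59)), torus size `P` (`P_μ ≥ 4`), nested family `D` of domains of the torus (2.1)–(2.2), weights
`a_i ∈ [a₋, a₊]`, `c_i ∈ [c₋, c₊]` with `a_{i+1} = aNext ℓ a_i c_i`, axis `μ`, and all `x ≠ x′` of one block `B^j(y)`: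
`|x′−x|_T^{−α}·|((G′λ)(x′+e_μ) − (G′λ)(x′)) − ((G′λ)(x+e_μ) − (G′λ)(x))| ≤ C_α·(L^{j})^{1−α}·e^{−½δ₀d_T(y,y′)}·|λ|`,
`supp λ ⊂ B^{j′}(y′)` (periodic shifts; lattice units; the Hölder quotient over the pairs of `B^j(y)` with the torus
sup-distance, the cut-off `ζ` and the factor `(‖ζ‖_α + |ζ|)` of print being dispensed with as in [3] (1.9)) — the
printed route with the box lineage's `α`-uniform per-term rate (`aX_dd_le_unif`). [cite: Balaban1984PropagatorsII, Proposition 2.2 (2.67) p.234 (fourth entry «(L^jη)^{1−α}(‖ζ‖_α + |ζ|)»), (2.64)–(2.66) p.234, p.224 (Ω₁ = T_η admitted); Balaban1983RegularityDecay, Theorem (1.9) p.573] -/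
theorem prop22_fourth_multiLevelTorus_unif (d ℓ : ℕ) (hℓ : 1 ≤ ℓ) (aminus aplus a2minus a2plus : ℝ)
    (ha : 0 < aminus) (ha2 : 0 < a2minus) :
    ∃ δ₀ M₀ : ℝ, ∃ N₀ : ℕ, 0 < δ₀ ∧ 0 < M₀ ∧ 0 < N₀ ∧ ∀ (α : ℝ), 0 ≤ α → α < 1 → ∃ C : ℝ, 0 < C ∧
      ∀ (k Mh R : ℕ), 3 ≤ Mh → M₀ ≤ ((ℓ : ℝ) + 1) * Mh → 2 * (ℓ + 1) ≤ R → N₀ + 1 ≤ R * ((ℓ + 1) * Mh) →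
      ∀ (P : Fin (d + 1) → ℕ) (hP : ∀ μ, 1 ≤ P μ) (hP4 : ∀ μ, 4 ≤ P μ) (D : TDomains d ℓ Mh k P R) (a c : ℕ → ℝ),
        (∀ i, 1 ≤ i → aminus ≤ a i ∧ a i ≤ aplus) → (∀ i, 1 ≤ i → a2minus ≤ c i ∧ c i ≤ a2plus) →
        (∀ i, 1 ≤ i → a (i + 1) = aNext ℓ (a i) (c i)) →
        ∀ (μ : Fin (d + 1)) (y' : ↥(bset D.toDomains)) (lam : ↥(boxDom (N0 ℓ Mh k P)) → ℝ) (B : ℝ),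
          BlockSupp (g := geomT D) (blkOf D.toDomains) lam y' B →
          ∀ (x x' : ↥(boxDom (N0 ℓ Mh k P))), x'.1 ≠ x.1 → blkOf D.toDomains x' = blkOf D.toDomains x →
            (torusSupNorm (N0 ℓ Mh k P) (x'.1 - x.1)) ^ (-α)
                * |((gmlT (N0 ℓ Mh k P) ℓ k D.lev a *ᵥ lam) (tshift (N0 ℓ Mh k P) (unitVec μ) x')
                      - (gmlT (N0 ℓ Mh k P) ℓ k D.lev a *ᵥ lam) x')
                    - ((gmlT (N0 ℓ Mh k P) ℓ k D.lev a *ᵥ lam) (tshift (N0 ℓ Mh k P) (unitVec μ) x)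
                      - (gmlT (N0 ℓ Mh k P) ℓ k D.lev a *ᵥ lam) x)|
              ≤ C * (((ℓ : ℝ) + 1) ^ D.lev x.1) ^ (1 - α)
                * Real.exp (-(δ₀ / 2 * (geomT D).dist (blkOf D.toDomains x) y')) * B := by
  obtain ⟨δ₀, M₀, N₀, hδ₀, hM₀, hN₀, hCA⟩ :=
    hasMajorant_holder_multiLevelTorus_unif d ℓ hℓ aminus aplus a2minus a2plus ha ha2
  refine ⟨δ₀, M₀, N₀, hδ₀, hM₀, hN₀, fun α hα0 hα1 => ?_⟩
  obtain ⟨C, hC, h⟩ := hCA α hα0 hα1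
  refine ⟨C, hC, ?_⟩
  intro k Mh R hMh hM hR hRM P hP hP4 D a c haw hcw hac μ y' lam B hlam x x' hne hblk
  have hMh1 : 1 ≤ Mh := le_trans (by norm_num) hMh
  have hmaj := h k Mh R hMh hM hR hRM P hP hP4 D a c haw hcw hac μ
  have hrow := rowBound_of_hasMajorant_liftL (g := geomT D) (blkOf D.toDomains) (blkPT D μ) hmaj y' lam B hlam
    (⟨x, x', hne, hblk⟩ : HPairT D μ)
  rw [holderOpT_apply, abs_mul,
    abs_of_nonneg (Real.rpow_nonneg (torusSupNorm_nonneg (one_le_N0 hMh1 hP) _) _)] at hrow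
  exact hrow

/-- **[B6] PROPOSITION 2.2, FOURTH ENTRY OF (2.67) (`‖ζ∇^η_xG′λ‖_α`), FOR THE GENUINE `k`-LEVEL OPERATOR
`G′ = Δ′_a^{−1}` ON THE TORUS `T_η`, AT A FIXED `α`** (print's carrier, `Ω₁ = T_η`): for `0 ≤ α < 1` there are
`δ₀, C, M₀ > 0` and `N₀ ≥ 1` (functions of `d`, `ℓ`, `α`, the windows — NOT of the torus) such that for EVERY number of
levels `k`, `M_h ≥ 3` with `L·M_h ≥ M₀`, `R ≥ 2L` with `RM ≥ N₀ + 1`, torus size `P` (`P_μ ≥ 4`), nested family `D`,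
weights in the windows with `a_{i+1} = aNext ℓ a_i c_i`, axis `μ`, and all `x ≠ x′` of one block `B^j(y)`:
`|x′−x|_T^{−α}·|((G′λ)(x′+e_μ) − (G′λ)(x′)) − ((G′λ)(x+e_μ) − (G′λ)(x))| ≤ C·(L^{j})^{1−α}·e^{−½δ₀d_T(y,y′)}·|λ|`,
`supp λ ⊂ B^{j′}(y′)`. [cite: Balaban1984PropagatorsII, Proposition 2.2 (2.67) p.234 (fourth entry), (2.64)–(2.66) p.234, p.224 (Ω₁ = T_η admitted); Balaban1983RegularityDecay, Theorem (1.9) p.573] -/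
theorem prop22_fourth_multiLevelTorus (d ℓ : ℕ) (hℓ : 1 ≤ ℓ) (aminus aplus a2minus a2plus : ℝ) (ha : 0 < aminus)
    (ha2 : 0 < a2minus) (α : ℝ) (hα0 : 0 ≤ α) (hα1 : α < 1) :
    ∃ δ₀ C M₀ : ℝ, ∃ N₀ : ℕ, 0 < δ₀ ∧ 0 < C ∧ 0 < M₀ ∧ 0 < N₀ ∧
      ∀ (k Mh R : ℕ), 3 ≤ Mh → M₀ ≤ ((ℓ : ℝ) + 1) * Mh → 2 * (ℓ + 1) ≤ R → N₀ + 1 ≤ R * ((ℓ + 1) * Mh) →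
      ∀ (P : Fin (d + 1) → ℕ) (hP : ∀ μ, 1 ≤ P μ) (hP4 : ∀ μ, 4 ≤ P μ) (D : TDomains d ℓ Mh k P R) (a c : ℕ → ℝ),
        (∀ i, 1 ≤ i → aminus ≤ a i ∧ a i ≤ aplus) → (∀ i, 1 ≤ i → a2minus ≤ c i ∧ c i ≤ a2plus) →
        (∀ i, 1 ≤ i → a (i + 1) = aNext ℓ (a i) (c i)) →
        ∀ (μ : Fin (d + 1)) (y' : ↥(bset D.toDomains)) (lam : ↥(boxDom (N0 ℓ Mh k P)) → ℝ) (B : ℝ),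
          BlockSupp (g := geomT D) (blkOf D.toDomains) lam y' B →
          ∀ (x x' : ↥(boxDom (N0 ℓ Mh k P))), x'.1 ≠ x.1 → blkOf D.toDomains x' = blkOf D.toDomains x →
            (torusSupNorm (N0 ℓ Mh k P) (x'.1 - x.1)) ^ (-α)
                * |((gmlT (N0 ℓ Mh k P) ℓ k D.lev a *ᵥ lam) (tshift (N0 ℓ Mh k P) (unitVec μ) x')
                      - (gmlT (N0 ℓ Mh k P) ℓ k D.lev a *ᵥ lam) x')
                    - ((gmlT (N0 ℓ Mh k P) ℓ k D.lev a *ᵥ lam) (tshift (N0 ℓ Mh k P) (unitVec μ) x)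
                      - (gmlT (N0 ℓ Mh k P) ℓ k D.lev a *ᵥ lam) x)|
              ≤ C * (((ℓ : ℝ) + 1) ^ D.lev x.1) ^ (1 - α)
                * Real.exp (-(δ₀ / 2 * (geomT D).dist (blkOf D.toDomains x) y')) * B := by
  obtain ⟨δ₀, M₀, N₀, hδ₀, hM₀, hN₀, h⟩ :=
    prop22_fourth_multiLevelTorus_unif d ℓ hℓ aminus aplus a2minus a2plus ha ha2
  obtain ⟨C, hC, h'⟩ := h α hα0 hα1
  exact ⟨δ₀, C, M₀, N₀, hδ₀, hC, hM₀, hN₀, h'⟩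

end Prop22

end

end Literature.MathematicalPhysics.QuantumFieldTheory.Balaban1983to89.B6Prop22HolderMultiLevelTorus
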